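import Literature.Combinatorics.Optimization.PsdRankBasicProperties
import Literature.Combinatorics.Optimization.PsdRankComparisons
import Literature.Analysis.Convex.LinearProgrammingDuality
import Literature.LinearAlgebra.Matrix.NearestPositiveSemidefinite
import HarnessLib

/-!
# Properties of the factors of a psd factorization: ranks and norms (FGPRT 2015, §6)

Source: H. Fawzi, J. Gouveia, P. A. Parrilo, R. Z. Robinson, R. R. Thomas, *Positive semidefinite
rank*, Math. Program. Ser. B 153 (2015) 133–177 = arXiv:1407.4095 [FawziEtAl2015], §6 "Properties of
factors" (held text `paper:arxiv-1407.4095`, chunks p18–p19; arXiv numbering). Vocabulary: the tree's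
`HasPsdFactorization` (Def. 2.2) and `HasHadamardSqrtOfRankLE` (Def. 5.2, `PsdRankComparisons.lean`).

Contents.
* Proposition 6.1 (Lee–Theis, via Pataki/Barvinok: factors of rank `≤ √(8q+1)/2` for the rows and
  `≤ √(8p+1)/2` for the columns): NAMED FACT `FawziEtAl2015_prop61`, DISCHARGED by
  `FawziEtAl2015_prop61_holds` (constructive Barvinok–Pataki rank reduction
  `exists_posSemidef_trace_eq_rank_small`: dimension count on symmetric perturbations `USUᵀ` of
  `A = UUᵀ`, then a step to the boundary of the psd cone via the spectral theorem); the same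
  dimension count gives the extreme-point form `rank_small_of_mem_extremePoints` (an extreme point
  of a `|κ|`-constraint slice of the psd cone has rank `r` with `r(r+1) ≤ 2|κ|`).
* Proposition 6.2 (`rank_√(M)` = smallest size of a psd factorization by rank-one factors): direction
  "Hadamard square root of rank `≤ k` ⇒ factorization of size `k` with factors of rank `≤ 1`" PROVED
  (`HasHadamardSqrtOfRankLE.exists_rankOne_psdFactorization`); converse NAMED FACT `FawziEtAl2015_prop62`.
* The standard example that `rank_psd M < rank_√(M)` is possible (Gouveia–Robinson–Thomas 2013,
  Example 2.3 [GouveiaRobinsonThomas2013, p05]: `M = [[1,1,1],[1,0,1],[0,1,1]]` has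
  `rank M = rank_√ M = 3` — EVERY Hadamard square root has odd, hence nonzero, determinant — while
  `rank_psd M = 2` by the printed size-2 factorization, whose first row / third column factors have
  rank two; by Proposition 6.2 no size-2 factorization by rank-one factors exists): PROVED, section
  `GrtEx23` (`GouveiaRobinsonThomas2013_ex23`, appended).
* Lemma 6.4 is `FawziEtAl2015_lemma213` (`PsdRankBasicProperties.lean`; Lemma 2.13 = Lemma 6.4) — not
  restated.
* Theorem 6.5 (John 1948) in the Lagrangian/KKT form actually used in §6.2, for a FINITE spanning
  family `u_i`: PROVED (`exists_john_position`: a positive definite `X` with `u_iᵀXu_i ≤ 1`,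
  multipliers `λ_i ≥ 0` on the contact points, `X⁻¹ = Σ λ_i u_iu_iᵀ`, `Σ λ_i = n`; maximal determinant
  over the compact feasible set, multipliers from Farkas' lemma `LPDuality.farkas_nonneg_eq` applied
  to a first-order perturbation, section `John`).
* Corollary 6.6 (John's-theorem rescaling of two bounded spanning sets `U, V` with `|⟨u,v⟩| ≤ Δ` by an
  invertible `L`: `‖Lu‖, ‖L⁻ᵀv‖ ≤ n^{1/4}√Δ`): NAMED FACT `FawziEtAl2015_cor66`, DISCHARGED by
  `FawziEtAl2015_cor66_holds` (finite-family form `exists_rescaling_of_abs_dotProduct_le` from John's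
  theorem, extended to bounded sets by a compactness / finite-intersection argument on the pairs
  `(L, L⁻¹)`).
* Corollary 6.7 (rank factorizations `M = AᵀB` with columns of norm `≤ k^{1/4}√‖M‖_∞`): NAMED FACT
  `FawziEtAl2015_cor67`, DISCHARGED by `FawziEtAl2015_cor67_holds` (rank factorisation through a
  basis of the column space + the finite Corollary 6.6).
* Corollary 6.8 (= Briët–Dadush–Pokutta Thm. 6, the SHARP rescaling: a psd-rank-`k` matrix has a size-`k`
  psd factorization whose factors have largest eigenvalue `≤ √(k‖M‖_∞)`): NAMED FACT
  `FawziEtAl2015_cor68`, DISCHARGED by `FawziEtAl2015_cor68_holds` (the printed proof: Cor. 6.6 applied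
  to `U = {u : uuᵀ ⪯ A'_i}`, `V = {v : vvᵀ ⪯ B'_j}` — with tiny multiples of the standard basis adjoined
  so that `U, V` span in the degenerate case — then `A_i = LA'_iLᵀ`, `B_j = L⁻ᵀB'_jL⁻¹`, the
  eigenvalue bound done with quadratic forms). The tree also PROVES the weak (polynomial-loss) form
  `Literature.Combinatorics.Optimization.BrietDadushPokutta2014_rescaleWeak_holds` /
  `HasPsdFactorization.rescale_weak` (`BlockPsdFactorization.lean`, `PsdFactorizationRescaling.lean`).

NOT here: Remark 6.3 (blow-up matrix `N` of square root rank `k`), Theorem 6.5 for general compact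
convex bodies (only the finite KKT form above), Remark 6.9.
-/

noncomputable section

open Matrix Finset
open scoped MatrixOrder

namespace Literature.Combinatorics.Optimization

variable {ι κ : Type*}

/-! ### §6.1 Rank of factors -/

/-- **FGPRT Proposition 6.1** (Lee–Theis; p18, verbatim): "If a `p × q` nonnegative matrix `M` has a
`S^k_+` factorization, then it has one using factors of rank at most `√(8q+1)/2` for the rows and at most
`√(8p+1)/2` for the columns" (fixing the row factors, the column factors range over a spectrahedron, which
has a point of rank `r` with `C(r+1,2) ≤` number of constraints — Pataki, Barvinok).
[cite: FawziEtAl2015, Prop. 6.1 (p18)] -/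
def FawziEtAl2015_prop61 : Prop :=
  ∀ (ι κ : Type) [Fintype ι] [Fintype κ] (M : ι → κ → ℝ) (k : ℕ), HasPsdFactorization M k →
    ∃ (A : ι → Matrix (Fin k) (Fin k) ℝ) (B : κ → Matrix (Fin k) (Fin k) ℝ),
      (∀ i, (A i).PosSemidef) ∧ (∀ j, (B j).PosSemidef) ∧ (∀ i j, M i j = (A i * B j).trace) ∧
      (∀ i, ((A i).rank : ℝ) ≤ Real.sqrt (8 * Fintype.card κ + 1) / 2) ∧
      ∀ j, ((B j).rank : ℝ) ≤ Real.sqrt (8 * Fintype.card ι + 1) / 2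

/-! ### Proposition 6.2: square root rank = rank-one psd factorizations -/

/-- **FGPRT Proposition 6.2, direction `⇒`** (p18): "if `M = N ∘ N` and `N` has rank `k`, then we can take a
rank factorization of `N`, `N = AᵀB`, and use it to create the matrices `A_i = a_i a_iᵀ` and
`B_j = b_j b_jᵀ` … These matrices have rank one [at most one] and form a `S^k_+` factorization of `M`."
[cite: FawziEtAl2015, Prop. 6.2 (p18)] -/
theorem HasHadamardSqrtOfRankLE.exists_rankOne_psdFactorization [Fintype ι] [Fintype κ]
    {M : Matrix ι κ ℝ} {k : ℕ} (h : HasHadamardSqrtOfRankLE M k) :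
    ∃ (A : ι → Matrix (Fin k) (Fin k) ℝ) (B : κ → Matrix (Fin k) (Fin k) ℝ),
      (∀ i, (A i).PosSemidef ∧ (A i).rank ≤ 1) ∧ (∀ j, (B j).PosSemidef ∧ (B j).rank ≤ 1) ∧
      ∀ i j, M i j = (A i * B j).trace := by
  classical
  obtain ⟨N, hN, hr⟩ := h
  obtain ⟨a, b, hab⟩ := exists_biFactorization_of_rank_le N hr
  refine ⟨fun i => vecMulVec (a i) (a i), fun j => vecMulVec (b j) (b j),
    fun i => ⟨by simpa using posSemidef_vecMulVec_self_star (a i), rank_vecMulVec_le _ _⟩,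
    fun j => ⟨by simpa using posSemidef_vecMulVec_self_star (b j), rank_vecMulVec_le _ _⟩,
    fun i j => ?_⟩
  rw [vecMulVec_mul_vecMulVec, trace_vecMulVec, dotProduct_smul, smul_eq_mul, ← hN i j, hab i j, sq]
  simp only [dotProduct]

/-- **FGPRT Proposition 6.2** (p18, verbatim): "The square root rank of `M`, `rank_√(M)`, is precisely the
smallest size of a psd factorization of `M` comprised solely of rank one factors." Direction `⇒` is
`HasHadamardSqrtOfRankLE.exists_rankOne_psdFactorization`; typed here is `⇐`: "if `v_iv_iᵀ` and `w_jw_jᵀ`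
form a `S^k_+` factorization of `M` then … `VᵀW` has rank [at most] `k` and is a Hadamard square root of
`M`". [cite: FawziEtAl2015, Prop. 6.2 (p18)] -/
def FawziEtAl2015_prop62 : Prop :=
  ∀ (ι κ : Type) [Fintype ι] [Fintype κ] (M : Matrix ι κ ℝ) (k : ℕ),
    (∃ (A : ι → Matrix (Fin k) (Fin k) ℝ) (B : κ → Matrix (Fin k) (Fin k) ℝ),
      (∀ i, (A i).PosSemidef ∧ (A i).rank ≤ 1) ∧ (∀ j, (B j).PosSemidef ∧ (B j).rank ≤ 1) ∧
      ∀ i j, M i j = (A i * B j).trace) →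
    HasHadamardSqrtOfRankLE M k

/-! ### §6.2 Norms of factors: John's-theorem rescalings -/

/-- **FGPRT Corollary 6.6** (p19, verbatim): "Suppose `U, V ⊆ ℝⁿ` are bounded and each span `ℝⁿ`, and `Δ =
max_{u∈U, v∈V} |⟨u,v⟩|`. Then there exists a linear operator `L : ℝⁿ → ℝⁿ` [invertible] such that
`max_{u∈U} ‖Lu‖₂` and `max_{v∈V} ‖(L⁻¹)ᵀv‖₂` are both less than or equal to `n^{1/4}√Δ`" (from John's theorem
6.5). Typed with `Δ` any common bound on `|⟨u,v⟩|` (the conclusion is monotone in `Δ`), `L` an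
invertible matrix, Euclidean norms `√(x·x)`. [cite: FawziEtAl2015, Cor. 6.6 (p19)] -/
def FawziEtAl2015_cor66 : Prop :=
  ∀ (n : ℕ) (U V : Set (Fin n → ℝ)) (Δ : ℝ), Bornology.IsBounded U → Bornology.IsBounded V →
    Submodule.span ℝ U = ⊤ → Submodule.span ℝ V = ⊤ → (∀ u ∈ U, ∀ v ∈ V, |u ⬝ᵥ v| ≤ Δ) →
    ∃ L : Matrix (Fin n) (Fin n) ℝ, IsUnit L.det ∧
      (∀ u ∈ U, Real.sqrt ((L *ᵥ u) ⬝ᵥ (L *ᵥ u)) ≤ (n : ℝ) ^ ((1 : ℝ) / 4) * Real.sqrt Δ) ∧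
      ∀ v ∈ V, Real.sqrt ((L⁻¹ᵀ *ᵥ v) ⬝ᵥ (L⁻¹ᵀ *ᵥ v)) ≤ (n : ℝ) ^ ((1 : ℝ) / 4) * Real.sqrt Δ

/-- **FGPRT Corollary 6.7** (p19, verbatim): "If `M ∈ ℝ^{p×q}` has rank `k`, then there exist `A ∈ ℝ^{k×p}`,
`B ∈ ℝ^{k×q}` such that `M = AᵀB` and the maximum `2`-norm of a column of `A` or `B` is at most
`k^{1/4}√‖M‖_∞`" (`‖M‖_∞` = largest absolute value of an entry; any bound `Δ` on it may be used).
[cite: FawziEtAl2015, Cor. 6.7 (p19)] -/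
def FawziEtAl2015_cor67 : Prop :=
  ∀ (ι κ : Type) [Fintype ι] [Fintype κ] (M : Matrix ι κ ℝ) (k : ℕ) (Δ : ℝ), M.rank = k →
    (∀ i j, |M i j| ≤ Δ) →
    ∃ (a : ι → Fin k → ℝ) (b : κ → Fin k → ℝ), (∀ i j, M i j = ∑ l, a i l * b j l) ∧
      (∀ i, Real.sqrt (∑ l, a i l ^ 2) ≤ (k : ℝ) ^ ((1 : ℝ) / 4) * Real.sqrt Δ) ∧
      ∀ j, Real.sqrt (∑ l, b j l ^ 2) ≤ (k : ℝ) ^ ((1 : ℝ) / 4) * Real.sqrt Δ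

/-- **FGPRT Corollary 6.8** (= Briët–Dadush–Pokutta 2015, Thm. 6, sharp form; p19, verbatim): "If `M ∈
ℝ^{p×q}_+` has psd rank `k`, then there exist `A_1, …, A_p, B_1, …, B_q ∈ S^k_+` such that `M_{ij} = ⟨A_i,B_j⟩`
and the largest eigenvalue of `A_i` and `B_j` is bounded above by `√(k‖M‖_∞)`." Typed for a matrix with a
psd factorization of size `k` (padding a smaller optimal factorization by zeros keeps the bound, which is
monotone in `k`) and any bound `Δ` on the entries; "largest eigenvalue `≤ c`" as `c·I − A ⪰ 0`. The
weak form with polynomial loss is PROVED in the tree (`BrietDadushPokutta2014_rescaleWeak_holds`).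
[cite: FawziEtAl2015, Cor. 6.8 (p19)] -/
def FawziEtAl2015_cor68 : Prop :=
  ∀ (ι κ : Type) [Fintype ι] [Fintype κ] (M : ι → κ → ℝ) (k : ℕ) (Δ : ℝ), (∀ i j, M i j ≤ Δ) →
    HasPsdFactorization M k →
    ∃ (A : ι → Matrix (Fin k) (Fin k) ℝ) (B : κ → Matrix (Fin k) (Fin k) ℝ),
      (∀ i, (A i).PosSemidef) ∧ (∀ j, (B j).PosSemidef) ∧ (∀ i j, M i j = (A i * B j).trace) ∧
      (∀ i, (Real.sqrt (k * Δ) • (1 : Matrix (Fin k) (Fin k) ℝ) - A i).PosSemidef) ∧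
      ∀ j, (Real.sqrt (k * Δ) • (1 : Matrix (Fin k) (Fin k) ℝ) - B j).PosSemidef

/-! ### Discharge of `FawziEtAl2015_prop62`: rank-one psd factors are Hadamard square roots -/

/-- A real psd matrix of rank `≤ 1` is `v vᵀ` (the step "`v_iv_iᵀ`" of the proof of Prop. 6.2: a rank
factorization `A = α βᵀ` of a nonzero symmetric psd `A` has a positive diagonal entry `A_{s₀s₀}`, and
`A = v vᵀ` with `v = A_{·,s₀}/√A_{s₀s₀}`). [cite: FawziEtAl2015, Prop. 6.2 proof (p18)] -/
private theorem exists_eq_vecMulVec_of_rank_le_one {k : ℕ} {A : Matrix (Fin k) (Fin k) ℝ}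
    (hA : A.PosSemidef) (hr : A.rank ≤ 1) : ∃ v : Fin k → ℝ, A = vecMulVec v v := by
  classical
  obtain ⟨a, b, hab⟩ := exists_biFactorization_of_rank_le A hr
  have hab' : ∀ s t, A s t = a s 0 * b t 0 := fun s t => by
    rw [hab s t, Fin.sum_univ_one]
  have hsymm : ∀ s t, A t s = A s t := fun s t => by simpa using hA.1.apply s t
  have hdiag : ∀ s, 0 ≤ A s s := fun s => by
    have h := (posSemidef_iff_dotProduct_mulVec.mp hA).2 (Pi.single s 1)
    rwa [mulVec_single, star_trivial, single_dotProduct, one_mul, MulOpposite.op_one, one_smul,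
      Matrix.col_apply] at h
  by_cases hzero : ∀ s t, A s t = 0
  · refine ⟨0, ?_⟩
    ext s t
    simp [vecMulVec_apply, hzero s t]
  · simp only [not_forall] at hzero
    obtain ⟨s₀, t₀, hst⟩ := hzero
    -- the diagonal entry `A s₀ s₀` is nonzero: `A s₀ t₀ = a s₀ b t₀ ≠ 0` and, by symmetry,
    -- `a t₀ b s₀ = a s₀ b t₀ ≠ 0`, so `a s₀ ≠ 0 ≠ b s₀`
    have h1 : a s₀ 0 * b t₀ 0 ≠ 0 := by rwa [← hab']
    have h2 : a t₀ 0 * b s₀ 0 ≠ 0 := by rwa [← hab', hsymm]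
    have hc : A s₀ s₀ ≠ 0 := by
      rw [hab']
      exact mul_ne_zero (left_ne_zero_of_mul h1) (right_ne_zero_of_mul h2)
    have hcpos : 0 < A s₀ s₀ := lt_of_le_of_ne (hdiag s₀) (Ne.symm hc)
    set c := A s₀ s₀ with hcdef
    refine ⟨fun s => A s s₀ / Real.sqrt c, ?_⟩
    ext s t
    rw [vecMulVec_apply, div_mul_div_comm, Real.mul_self_sqrt hcpos.le]
    -- `A s s₀ * A t s₀ = A s t * A s₀ s₀`
    have key : A s s₀ * A t s₀ = A s t * c := by
      rw [hsymm s₀ t, hcdef, hab' s s₀, hab' s₀ t, hab' s t, hab' s₀ s₀]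
      ring
    rw [key, mul_div_assoc, div_self (ne_of_gt hcpos), mul_one]

/-- **Discharge of `FawziEtAl2015_prop62`** (Prop. 6.2, direction `⇐`): "if `v_iv_iᵀ` and `w_jw_jᵀ` form a
`S^k_+` factorization of `M` then setting `V` and `W` to be the matrices whose columns are the `v_i` and
the `w_j` respectively, we can obtain a matrix `VᵀW` that has rank [at most] `k` and is a Hadamard square
root of `M`" (`⟨v vᵀ, w wᵀ⟩ = ⟨v,w⟩²`). [cite: FawziEtAl2015, Prop. 6.2 (p18)] -/
theorem FawziEtAl2015_prop62_holds : FawziEtAl2015_prop62 := by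
  intro ι κ _ _ M k h
  classical
  obtain ⟨A, B, hA, hB, hM⟩ := h
  choose v hv using fun i => exists_eq_vecMulVec_of_rank_le_one (hA i).1 (hA i).2
  choose w hw using fun j => exists_eq_vecMulVec_of_rank_le_one (hB j).1 (hB j).2
  refine ⟨Matrix.of fun i j => v i ⬝ᵥ w j, fun i j => ?_, ?_⟩
  · rw [Matrix.of_apply, hM i j, hv i, hw j, vecMulVec_mul_vecMulVec, trace_vecMulVec, dotProduct_smul,
      smul_eq_mul, sq, dotProduct_comm (v i) (w j)]
  · have hfac : (Matrix.of fun i j => v i ⬝ᵥ w j) =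
        (Matrix.of fun i l => v i l) * (Matrix.of fun l j => w j l) := by
      ext i j
      simp [Matrix.mul_apply, dotProduct]
    rw [hfac]
    calc ((Matrix.of fun i l => v i l) * (Matrix.of fun l j => w j l)).rank
        ≤ (Matrix.of fun (i : ι) (l : Fin k) => v i l).rank := Matrix.rank_mul_le_left _ _
      _ ≤ Fintype.card (Fin k) := Matrix.rank_le_card_width _
      _ = k := Fintype.card_fin k


/-! ### Discharge of `FawziEtAl2015_prop61`: Barvinok–Pataki rank reduction -/

section Pataki

/-- Swapping a product of two sums against an inner sum. [folklore] -/
private theorem sum_mul_sum_swap₆ {ι : Type*} [Fintype ι] {r : ℕ} (a : ι → Fin r → ℝ)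
    (u w : Fin r → ℝ) :
    ∑ p, (∑ l, a p l * u l) * ∑ l', a p l' * w l' = ∑ l, ∑ l', u l * w l' * ∑ p, a p l * a p l' := by
  calc ∑ p, (∑ l, a p l * u l) * ∑ l', a p l' * w l'
      = ∑ p, ∑ l, ∑ l', a p l * u l * (a p l' * w l') :=
        sum_congr rfl fun p _ => Finset.sum_mul_sum _ _ _ _
    _ = ∑ l, ∑ p, ∑ l', a p l * u l * (a p l' * w l') := Finset.sum_comm
    _ = ∑ l, ∑ l', ∑ p, a p l * u l * (a p l' * w l') :=
        sum_congr rfl fun l _ => Finset.sum_comm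
    _ = ∑ l, ∑ l', u l * w l' * ∑ p, a p l * a p l' :=
        sum_congr rfl fun l _ => sum_congr rfl fun l' _ => by
          rw [Finset.mul_sum]
          exact sum_congr rfl fun p _ => by ring

/-- A real psd matrix of rank `r` is `UUᵀ` with `U` having `r` columns (Gram vectors in `ℝ^{rank}`).
[folklore] -/
private theorem exists_eq_mul_transpose_of_posSemidef {k : ℕ} {A : Matrix (Fin k) (Fin k) ℝ}
    (hA : A.PosSemidef) : ∃ U : Matrix (Fin k) (Fin A.rank) ℝ, A = U * Uᵀ := by
  classical
  obtain ⟨C, hC⟩ := CStarAlgebra.nonneg_iff_eq_star_mul_self.mp hA.nonneg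
  have hCT : star C = Cᵀ := by
    rw [star_eq_conjTranspose, conjTranspose_eq_transpose_of_trivial]
  have hrank : C.rank = A.rank := by rw [hC, hCT, Matrix.rank_transpose_mul_self]
  obtain ⟨a, b, hab⟩ := exists_biFactorization_of_rank_le C hrank.le
  let A' : Matrix (Fin k) (Fin A.rank) ℝ := Matrix.of fun p l => a p l
  have hG : (A'ᵀ * A').PosSemidef := by
    simpa [conjTranspose_eq_transpose_of_trivial] using posSemidef_conjTranspose_mul_self A'
  obtain ⟨R, hR⟩ := CStarAlgebra.nonneg_iff_eq_star_mul_self.mp hG.nonneg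
  have hRT : star R = Rᵀ := by
    rw [star_eq_conjTranspose, conjTranspose_eq_transpose_of_trivial]
  rw [hRT] at hR
  have hGapply : ∀ l l', ∑ p, a p l * a p l' = ∑ m, R m l * R m l' := fun l l' => by
    have h := congrFun (congrFun hR l) l'
    simp only [Matrix.mul_apply, transpose_apply, A', Matrix.of_apply] at h
    exact h
  refine ⟨Matrix.of fun i m => ∑ l, R m l * b i l, ?_⟩
  ext i j
  have hAij : A i j = ∑ p, C p i * C p j := by
    rw [hC, hCT, Matrix.mul_apply]
    rfl
  rw [Matrix.mul_apply]
  simp only [Matrix.of_apply, transpose_apply]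
  calc A i j = ∑ p, (∑ l, a p l * b i l) * ∑ l', a p l' * b j l' := by
        rw [hAij]
        exact sum_congr rfl fun p _ => by rw [hab p i, hab p j]
    _ = ∑ l, ∑ l', b i l * b j l' * ∑ p, a p l * a p l' := sum_mul_sum_swap₆ a (b i) (b j)
    _ = ∑ l, ∑ l', b i l * b j l' * ∑ m, R m l * R m l' := by simp_rw [hGapply]
    _ = ∑ m, (∑ l, R m l * b i l) * ∑ l', R m l' * b j l' := (sum_mul_sum_swap₆ R (b i) (b j)).symm

/-- The symmetrisation map `T ↦ T + Tᵀ`. [folklore] -/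
private def symmetrize (r : ℕ) : Matrix (Fin r) (Fin r) ℝ →ₗ[ℝ] Matrix (Fin r) (Fin r) ℝ where
  toFun T := T + Tᵀ
  map_add' T T' := by rw [transpose_add]; abel
  map_smul' c T := by rw [transpose_smul, RingHom.id_apply, smul_add]

/-- The antisymmetric `r × r` matrices (the kernel of `T ↦ T + Tᵀ`) have dimension at most the number
`(r² − r)/2` of positions above the diagonal. [folklore] -/
private theorem finrank_ker_symmetrize_le (r : ℕ) :
    2 * Module.finrank ℝ (LinearMap.ker (symmetrize r)) + r ≤ r * r := by
  classical
  -- strictly-upper positions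
  let P := {p : Fin r × Fin r // p.1 < p.2}
  -- the coordinate map is injective on antisymmetric matrices
  let L : LinearMap.ker (symmetrize r) →ₗ[ℝ] (P → ℝ) :=
    { toFun := fun T p => (T : Matrix (Fin r) (Fin r) ℝ) p.1.1 p.1.2
      map_add' := fun T T' => by ext p; rfl
      map_smul' := fun c T => by ext p; rfl }
  have hL : Function.Injective L := by
    intro T T' h
    apply Subtype.ext
    have hT := T.2
    have hT' := T'.2
    rw [LinearMap.mem_ker] at hT hT'
    change (T : Matrix (Fin r) (Fin r) ℝ) + (T : Matrix (Fin r) (Fin r) ℝ)ᵀ = 0 at hT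
    change (T' : Matrix (Fin r) (Fin r) ℝ) + (T' : Matrix (Fin r) (Fin r) ℝ)ᵀ = 0 at hT'
    have anti : ∀ {S : Matrix (Fin r) (Fin r) ℝ}, S + Sᵀ = 0 → ∀ i j, S j i = -S i j := by
      intro S hS i j
      have h := congrFun (congrFun hS i) j
      simp only [Matrix.add_apply, transpose_apply, Matrix.zero_apply] at h
      linarith
    have hup : ∀ i j, i < j → (T : Matrix (Fin r) (Fin r) ℝ) i j = (T' : Matrix (Fin r) (Fin r) ℝ) i j :=
      fun i j hij => congrFun h ⟨(i, j), hij⟩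
    ext i j
    rcases lt_trichotomy i j with hij | rfl | hji
    · exact hup i j hij
    · have h1 := anti hT i i
      have h2 := anti hT' i i
      linarith
    · rw [anti hT j i, anti hT' j i, hup j i hji]
  have h1 : Module.finrank ℝ (LinearMap.ker (symmetrize r)) ≤ Fintype.card P := by
    have := LinearMap.finrank_le_finrank_of_injective hL
    rwa [Module.finrank_fintype_fun_eq_card] at this
  -- `2 |P| + r = r²`
  have h2 : 2 * Fintype.card P + r = r * r := by
    have hP : Fintype.card P = (univ.filter fun p : Fin r × Fin r => p.1 < p.2).card :=
      Fintype.card_subtype _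
    have hswap : (univ.filter fun p : Fin r × Fin r => p.2 < p.1).card =
        (univ.filter fun p : Fin r × Fin r => p.1 < p.2).card := by
      refine Finset.card_bij (fun p _ => (p.2, p.1)) (fun p hp => ?_) (fun p _ q _ h => ?_)
        (fun q hq => ⟨(q.2, q.1), ?_, rfl⟩)
      · simpa using hp
      · exact Prod.ext (congrArg Prod.snd h) (congrArg Prod.fst h)
      · simpa using hq
    have hunion : (univ.filter fun p : Fin r × Fin r => p.1 < p.2) ∪
        (univ.filter fun p : Fin r × Fin r => p.2 < p.1) = (univ : Finset (Fin r)).offDiag := by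
      ext p
      simp only [Finset.mem_union, Finset.mem_filter, Finset.mem_univ, true_and, Finset.mem_offDiag]
      exact ⟨fun h => h.elim ne_of_lt fun h' => (ne_of_lt h').symm, lt_or_gt_of_ne⟩
    have hdisj : Disjoint (univ.filter fun p : Fin r × Fin r => p.1 < p.2)
        (univ.filter fun p : Fin r × Fin r => p.2 < p.1) := by
      rw [Finset.disjoint_filter]
      exact fun p _ h => lt_asymm h
    have hcard := Finset.card_union_of_disjoint hdisj
    rw [hunion, Finset.offDiag_card, Finset.card_univ, Fintype.card_fin, hswap] at hcard
    have hr : r ≤ r * r := Nat.le_mul_self r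
    omega
  omega

/-- **Dimension count** (Barvinok–Pataki): more than `|κ|`… precisely, if `|κ| < r(r+1)/2` then some
nonzero symmetric `r × r` matrix lies in the kernel of any linear map to `ℝ^κ`. [folklore] -/
private theorem exists_symm_ne_zero_map_eq_zero {r : ℕ} {κ : Type*} [Fintype κ]
    (Φ : Matrix (Fin r) (Fin r) ℝ →ₗ[ℝ] (κ → ℝ)) (hκ : 2 * Fintype.card κ < r * (r + 1)) :
    ∃ S : Matrix (Fin r) (Fin r) ℝ, Sᵀ = S ∧ S ≠ 0 ∧ Φ S = 0 := by
  classical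
  let Φ' := Φ ∘ₗ symmetrize r
  have hker : r * r ≤ Module.finrank ℝ (LinearMap.ker Φ') + Fintype.card κ := by
    have h1 := LinearMap.finrank_range_add_finrank_ker Φ'
    rw [Module.finrank_matrix, Module.finrank_self, mul_one, Fintype.card_fin] at h1
    have h2 : Module.finrank ℝ (LinearMap.range Φ') ≤ Fintype.card κ := by
      have := Submodule.finrank_le (LinearMap.range Φ')
      rwa [Module.finrank_fintype_fun_eq_card] at this
    omega
  have hnot : ¬ LinearMap.ker Φ' ≤ LinearMap.ker (symmetrize r) := by
    intro hle
    have h1 := Submodule.finrank_mono hle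
    have h2 := finrank_ker_symmetrize_le r
    have h3 : r * (r + 1) = r * r + r := by ring
    omega
  obtain ⟨T, hT, hTσ⟩ := SetLike.not_le_iff_exists.mp hnot
  rw [LinearMap.mem_ker] at hT hTσ
  refine ⟨T + Tᵀ, by rw [transpose_add, transpose_transpose, add_comm], hTσ, hT⟩

/-- **Moving to the boundary of the psd cone**: for a nonzero symmetric `S`, some `I + tS` is psd and
singular. [folklore] -/
private theorem exists_posSemidef_rank_lt {r : ℕ} {S : Matrix (Fin r) (Fin r) ℝ} (hS : Sᵀ = S)
    (hS0 : S ≠ 0) : ∃ t : ℝ, (1 + t • S).PosSemidef ∧ (1 + t • S).rank < r := by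
  classical
  have hH : S.IsHermitian := by
    rw [IsHermitian, conjTranspose_eq_transpose_of_trivial, hS]
  have hr : 0 < r := by
    rcases Nat.eq_zero_or_pos r with h | h
    · subst h; exact absurd (Subsingleton.elim S 0) hS0
    · exact h
  haveI : Nonempty (Fin r) := ⟨⟨0, hr⟩⟩
  -- an eigenvalue of largest modulus, nonzero
  set ev := hH.eigenvalues with hev
  obtain ⟨a, ha⟩ := Finite.exists_max fun i => |ev i|
  have hne : ev ≠ 0 := fun h => hS0 (hH.eigenvalues_eq_zero_iff.mp h)
  have ha0 : ev a ≠ 0 := by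
    intro h0
    apply hne
    funext i
    have := ha i
    rw [h0, abs_zero] at this
    exact abs_eq_zero.mp (le_antisymm this (abs_nonneg _))
  set E : Matrix (Fin r) (Fin r) ℝ := (hH.eigenvectorUnitary : Matrix (Fin r) (Fin r) ℝ) with hE
  have hEE : E * star E = 1 := Unitary.coe_mul_star_self hH.eigenvectorUnitary
  have hSdiag : S = E * diagonal ev * star E := by
    have h := hH.spectral_theorem
    rw [Unitary.conjStarAlgAut_apply] at h
    simpa [RCLike.ofReal_real_eq_id] using h
  refine ⟨-(ev a)⁻¹, ?_, ?_⟩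
  all_goals
    have hdec : (1 : Matrix (Fin r) (Fin r) ℝ) + (-(ev a)⁻¹) • S =
        E * diagonal (fun i => 1 - ev i / ev a) * star E := by
      have hd : (diagonal fun i => 1 - ev i / ev a) = 1 + (-(ev a)⁻¹) • diagonal ev := by
        ext i j
        by_cases hij : i = j
        · subst hij; simp [div_eq_mul_inv]; ring
        · simp [hij]
      rw [hd, Matrix.mul_add, Matrix.add_mul, Matrix.mul_one, hEE, Matrix.mul_smul, Matrix.smul_mul,
        ← hSdiag]
  · rw [hdec]
    have hD : (diagonal fun i => 1 - ev i / ev a).PosSemidef := by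
      refine PosSemidef.diagonal fun i => ?_
      simp only [Pi.zero_apply, sub_nonneg]
      calc ev i / ev a ≤ |ev i / ev a| := le_abs_self _
        _ = |ev i| / |ev a| := abs_div _ _
        _ ≤ 1 := div_le_one_of_le₀ (ha i) (abs_nonneg _)
    have := hD.mul_mul_conjTranspose_same E
    rwa [star_eq_conjTranspose] 
  · rw [hdec]
    have hEdet : IsUnit E.det := Matrix.UnitaryGroup.det_isUnit hH.eigenvectorUnitary
    have hEdet' : IsUnit (star E).det := by
      rw [star_eq_conjTranspose, det_conjTranspose]
      exact hEdet.star
    rw [rank_mul_eq_left_of_isUnit_det (star E) _ hEdet', rank_mul_eq_right_of_isUnit_det E _ hEdet,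
      rank_diagonal]
    calc Fintype.card {i // 1 - ev i / ev a ≠ 0} < Fintype.card (Fin r) :=
          Fintype.card_subtype_lt (x := a) (by simp [div_self ha0])
      _ = r := Fintype.card_fin r

/-- **The Barvinok–Pataki rank-reduction step, iterated**: in an affine slice
`{A ⪰ 0 : Tr(A B_j) = Tr(A₀ B_j) ∀ j}` of the psd cone cut out by `|κ|` trace constraints there is a
point of rank `r` with `r(r+1)/2 ≤ |κ|`. [cite: FawziEtAl2015, Prop. 6.1 proof (p18, after Barvinok and Pataki)] -/
theorem exists_posSemidef_trace_eq_rank_small {k : ℕ} {κ : Type*} [Fintype κ]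
    (B : κ → Matrix (Fin k) (Fin k) ℝ) (A : Matrix (Fin k) (Fin k) ℝ) (hA : A.PosSemidef) :
    ∃ A' : Matrix (Fin k) (Fin k) ℝ, A'.PosSemidef ∧ (∀ j, (A' * B j).trace = (A * B j).trace) ∧
      A'.rank * (A'.rank + 1) ≤ 2 * Fintype.card κ := by
  classical
  -- strong induction on the rank
  suffices h : ∀ (n : ℕ) (A : Matrix (Fin k) (Fin k) ℝ), A.rank = n → A.PosSemidef →
      ∃ A' : Matrix (Fin k) (Fin k) ℝ, A'.PosSemidef ∧ (∀ j, (A' * B j).trace = (A * B j).trace) ∧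
        A'.rank * (A'.rank + 1) ≤ 2 * Fintype.card κ from h _ A rfl hA
  intro n
  induction n using Nat.strong_induction_on with
  | _ n ih =>
    intro A hAn hA
    by_cases hsmall : A.rank * (A.rank + 1) ≤ 2 * Fintype.card κ
    · exact ⟨A, hA, fun j => rfl, hsmall⟩
    -- `A = UUᵀ` with `rank A` columns; perturb inside the range
    set r := A.rank with hr
    obtain ⟨U, hU⟩ := exists_eq_mul_transpose_of_posSemidef hA
    let Φ : Matrix (Fin r) (Fin r) ℝ →ₗ[ℝ] (κ → ℝ) :=
      { toFun := fun S j => (U * S * Uᵀ * B j).trace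
        map_add' := fun S S' => by
          funext j
          simp only [Matrix.mul_add, Matrix.add_mul, trace_add, Pi.add_apply]
        map_smul' := fun c S => by
          funext j
          simp only [Matrix.mul_smul, Matrix.smul_mul, trace_smul, Pi.smul_apply, RingHom.id_apply] }
    obtain ⟨S, hSsym, hS0, hΦS⟩ := exists_symm_ne_zero_map_eq_zero Φ (by omega)
    obtain ⟨t, hpsd, hrank⟩ := exists_posSemidef_rank_lt hSsym hS0
    -- the new point `A'' = U (I + tS) Uᵀ`
    let A'' : Matrix (Fin k) (Fin k) ℝ := U * (1 + t • S) * Uᵀ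
    have hA''psd : A''.PosSemidef := by
      have := hpsd.mul_mul_conjTranspose_same U
      rwa [conjTranspose_eq_transpose_of_trivial] at this
    have hA''tr : ∀ j, (A'' * B j).trace = (A * B j).trace := by
      intro j
      have h0 : (U * S * Uᵀ * B j).trace = 0 := congrFun hΦS j
      simp only [A'', Matrix.mul_add, Matrix.add_mul, Matrix.mul_one, Matrix.mul_smul, Matrix.smul_mul,
        trace_add, trace_smul, h0, smul_zero, add_zero, hU]
    have hA''rank : A''.rank < n := by
      calc A''.rank ≤ (U * (1 + t • S)).rank := rank_mul_le_left _ _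
        _ ≤ (1 + t • S).rank := rank_mul_le_right _ _
        _ < r := hrank
        _ = n := hAn
    obtain ⟨A', hA'psd, hA'tr, hA'rank⟩ := ih _ hA''rank A'' rfl hA''psd
    exact ⟨A', hA'psd, fun j => (hA'tr j).trans (hA''tr j), hA'rank⟩

/-- `r(r+1) ≤ 2K ⟹ r ≤ √(8K+1)/2`. [folklore] -/
private theorem rank_bound_of_mul_succ_le {r K : ℕ} (h : r * (r + 1) ≤ 2 * K) :
    (r : ℝ) ≤ Real.sqrt (8 * K + 1) / 2 := by
  have h' : ((r : ℝ) * (r + 1)) ≤ 2 * K := by exact_mod_cast h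
  have h2 : (2 * (r : ℝ) + 1) ≤ Real.sqrt (8 * K + 1) := by
    apply Real.le_sqrt_of_sq_le
    nlinarith
  have h3 : (0 : ℝ) ≤ 1 := zero_le_one
  linarith

/-- **Discharge of `FawziEtAl2015_prop61`** (Barvinok–Pataki bound on factor ranks): apply the
rank-reduction `exists_posSemidef_trace_eq_rank_small` to every row factor (constraints indexed by the
columns) and then to every column factor (constraints indexed by the rows, against the new row
factors). [cite: FawziEtAl2015, Prop. 6.1 (p18)] -/
theorem FawziEtAl2015_prop61_holds : FawziEtAl2015_prop61 := by
  intro ι κ _ _ M k hM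
  classical
  obtain ⟨A, B, hA, hB, hMAB⟩ := hM
  -- reduce the row factors
  have hrow := fun i => exists_posSemidef_trace_eq_rank_small B (A i) (hA i)
  choose A' hA'psd hA'tr hA'rank using hrow
  -- reduce the column factors against the new row factors
  have hcol := fun j => exists_posSemidef_trace_eq_rank_small A' (B j) (hB j)
  choose B' hB'psd hB'tr hB'rank using hcol
  refine ⟨A', B', hA'psd, hB'psd, fun i j => ?_, fun i => rank_bound_of_mul_succ_le (hA'rank i),
    fun j => rank_bound_of_mul_succ_le (hB'rank j)⟩
  rw [hMAB i j, ← hA'tr i j, ← trace_mul_comm (B' j), hB'tr j i, trace_mul_comm]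

end Pataki

/-! ### Barvinok–Pataki for extreme points: `rank r` with `r(r+1) ≤ 2·#constraints` -/

section PatakiExtreme

/-- For a nonzero symmetric `S`, both `I + tS` and `I − tS` are psd for some `t ≠ 0` (take
`t = 1/λ` for an eigenvalue `λ` of largest modulus). [folklore] -/
private theorem exists_posSemidef_one_add_sub_smul {r : ℕ} {S : Matrix (Fin r) (Fin r) ℝ}
    (hS : Sᵀ = S) (hS0 : S ≠ 0) :
    ∃ t : ℝ, t ≠ 0 ∧ (1 + t • S).PosSemidef ∧ (1 - t • S).PosSemidef := by
  classical
  have hH : S.IsHermitian := by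
    rw [IsHermitian, conjTranspose_eq_transpose_of_trivial, hS]
  have hr : 0 < r := by
    rcases Nat.eq_zero_or_pos r with h | h
    · subst h; exact absurd (Subsingleton.elim S 0) hS0
    · exact h
  haveI : Nonempty (Fin r) := ⟨⟨0, hr⟩⟩
  set ev := hH.eigenvalues with hev
  obtain ⟨a, ha⟩ := Finite.exists_max fun i => |ev i|
  have hne : ev ≠ 0 := fun h => hS0 (hH.eigenvalues_eq_zero_iff.mp h)
  have ha0 : ev a ≠ 0 := by
    intro h0
    apply hne
    funext i
    have := ha i
    rw [h0, abs_zero] at this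
    exact abs_eq_zero.mp (le_antisymm this (abs_nonneg _))
  set E : Matrix (Fin r) (Fin r) ℝ := (hH.eigenvectorUnitary : Matrix (Fin r) (Fin r) ℝ) with hE
  have hEE : E * star E = 1 := Unitary.coe_mul_star_self hH.eigenvectorUnitary
  have hSdiag : S = E * diagonal ev * star E := by
    have h := hH.spectral_theorem
    rw [Unitary.conjStarAlgAut_apply] at h
    simpa [RCLike.ofReal_real_eq_id] using h
  -- `I + cS = E · diag(1 + c λ_i) · Eᵀ`
  have hdec : ∀ c : ℝ, (1 : Matrix (Fin r) (Fin r) ℝ) + c • S =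
      E * diagonal (fun i => 1 + c * ev i) * star E := by
    intro c
    have hd : (diagonal fun i => 1 + c * ev i) = 1 + c • diagonal ev := by
      ext i j
      by_cases hij : i = j
      · subst hij; simp
      · simp [hij]
    rw [hd, Matrix.mul_add, Matrix.add_mul, Matrix.mul_one, hEE, Matrix.mul_smul, Matrix.smul_mul,
      ← hSdiag]
  have hquot : ∀ i, |ev i / ev a| ≤ 1 := fun i => by
    rw [abs_div]
    exact div_le_one_of_le₀ (ha i) (abs_nonneg _)
  have hpsd : ∀ c : ℝ, (∀ i, 0 ≤ 1 + c * ev i) → ((1 : Matrix (Fin r) (Fin r) ℝ) + c • S).PosSemidef := by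
    intro c hc
    rw [hdec c]
    have hD : (diagonal fun i => 1 + c * ev i).PosSemidef := PosSemidef.diagonal fun i => hc i
    have := hD.mul_mul_conjTranspose_same E
    rwa [star_eq_conjTranspose]
  refine ⟨(ev a)⁻¹, inv_ne_zero ha0, hpsd _ fun i => ?_, ?_⟩
  · have h := (abs_le.mp (hquot i)).1
    rw [div_eq_mul_inv] at h
    linarith [mul_comm (ev a)⁻¹ (ev i)]
  · rw [sub_eq_add_neg, ← neg_smul]
    refine hpsd _ fun i => ?_
    have h := (abs_le.mp (hquot i)).2
    rw [div_eq_mul_inv] at h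
    linarith [mul_comm (ev a)⁻¹ (ev i)]

/-- If `A = UUᵀ` has rank equal to the number of columns of `U`, then `USUᵀ = 0` forces `S = 0`.
[folklore] -/
private theorem eq_zero_of_conj_eq_zero {k r : ℕ} (U : Matrix (Fin k) (Fin r) ℝ)
    (hU : (U * Uᵀ).rank = r) {S : Matrix (Fin r) (Fin r) ℝ} (h : U * S * Uᵀ = 0) : S = 0 := by
  classical
  set G := Uᵀ * U with hG
  have hGrank : G.rank = r := by rw [hG, rank_transpose_mul_self, ← rank_self_mul_transpose, hU]
  have hGunit : IsUnit G := by
    refine linearIndependent_rows_iff_isUnit.mp (linearIndependent_iff_card_eq_finrank_span.mpr ?_)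
    rw [Fintype.card_fin, Set.finrank, ← rank_eq_finrank_span_row, hGrank]
  have hGSG : G * S * G = 0 := by
    rw [hG]
    calc Uᵀ * U * S * (Uᵀ * U) = Uᵀ * (U * S * Uᵀ) * U := by
          simp only [Matrix.mul_assoc]
      _ = 0 := by rw [h, Matrix.mul_zero, Matrix.zero_mul]
  have h1 : G * S = 0 := (hGunit.mul_left_eq_zero).mp hGSG
  exact (hGunit.mul_right_eq_zero).mp h1

/-- **Barvinok–Pataki bound for extreme points**: an extreme point of a slice
`{X ⪰ 0 : Tr(X B_j) = c_j, j ∈ κ}` of the psd cone has rank `r` with `r(r+1) ≤ 2|κ|` (otherwise a nonzero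
symmetric perturbation `±tUSUᵀ` inside the range stays feasible). [cite: FawziEtAl2015, Prop. 6.1 proof
(p18, after Barvinok and Pataki)] -/
theorem rank_small_of_mem_extremePoints {k : ℕ} {κ : Type*} [Fintype κ]
    (B : κ → Matrix (Fin k) (Fin k) ℝ) (c : κ → ℝ) {A : Matrix (Fin k) (Fin k) ℝ}
    (hA : A ∈ Set.extremePoints ℝ {X : Matrix (Fin k) (Fin k) ℝ | X.PosSemidef ∧ ∀ j, (X * B j).trace = c j}) :
    A.rank * (A.rank + 1) ≤ 2 * Fintype.card κ := by
  classical
  by_contra hlt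
  rw [mem_extremePoints] at hA
  obtain ⟨⟨hApsd, hAc⟩, hext⟩ := hA
  obtain ⟨U, hU⟩ := exists_eq_mul_transpose_of_posSemidef hApsd
  let Φ : Matrix (Fin A.rank) (Fin A.rank) ℝ →ₗ[ℝ] (κ → ℝ) :=
    { toFun := fun S j => (U * S * Uᵀ * B j).trace
      map_add' := fun S S' => by
        funext j
        simp only [Matrix.mul_add, Matrix.add_mul, trace_add, Pi.add_apply]
      map_smul' := fun c S => by
        funext j
        simp only [Matrix.mul_smul, Matrix.smul_mul, trace_smul, Pi.smul_apply, RingHom.id_apply] }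
  obtain ⟨S, hSsym, hS0, hΦS⟩ := exists_symm_ne_zero_map_eq_zero Φ (by omega)
  obtain ⟨t, ht0, hplus, hminus⟩ := exists_posSemidef_one_add_sub_smul hSsym hS0
  -- the two perturbed feasible points
  let X : ℝ → Matrix (Fin k) (Fin k) ℝ := fun s => U * (1 + s • S) * Uᵀ
  have hXmem : ∀ s, ((1 : Matrix _ _ ℝ) + s • S).PosSemidef →
      X s ∈ {X : Matrix (Fin k) (Fin k) ℝ | X.PosSemidef ∧ ∀ j, (X * B j).trace = c j} := by
    intro s hs
    refine ⟨?_, fun j => ?_⟩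
    · have := hs.mul_mul_conjTranspose_same U
      rwa [conjTranspose_eq_transpose_of_trivial] at this
    · have h0 : (U * S * Uᵀ * B j).trace = 0 := congrFun hΦS j
      have := hAc j
      rw [hU] at this
      simp only [X, Matrix.mul_add, Matrix.add_mul, Matrix.mul_one, Matrix.mul_smul, Matrix.smul_mul,
        trace_add, trace_smul, h0, smul_zero, add_zero, this]
  have hXt := hXmem t hplus
  have hXnt : X (-t) ∈ {X : Matrix (Fin k) (Fin k) ℝ | X.PosSemidef ∧ ∀ j, (X * B j).trace = c j} := by
    refine hXmem (-t) ?_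
    rwa [neg_smul, ← sub_eq_add_neg]
  -- `A` is the midpoint
  have hmid : A ∈ openSegment ℝ (X t) (X (-t)) := by
    refine ⟨1 / 2, 1 / 2, by norm_num, by norm_num, by norm_num, ?_⟩
    simp only [X, neg_smul, Matrix.mul_add, Matrix.add_mul, Matrix.mul_one, Matrix.mul_neg,
      Matrix.neg_mul, smul_add, smul_neg, ← hU]
    rw [show (1 / 2 : ℝ) • A + (1 / 2 : ℝ) • (U * (t • S) * Uᵀ) + ((1 / 2 : ℝ) • A + -((1 / 2 : ℝ) •
      (U * (t • S) * Uᵀ))) = A by module]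
  have hXA := (hext _ hXt _ hXnt hmid).1
  -- hence `t USUᵀ = 0`, so `S = 0`
  have hUSU : U * (t • S) * Uᵀ = 0 := by
    have h1 : X t = A + U * (t • S) * Uᵀ := by
      simp only [X, Matrix.mul_add, Matrix.add_mul, Matrix.mul_one, ← hU]
    have h2 := hXA
    rw [h1] at h2
    simpa using h2
  have hrankU : (U * Uᵀ).rank = A.rank := by rw [← hU]
  have htS : t • S = 0 := eq_zero_of_conj_eq_zero U hrankU hUSU
  exact hS0 ((smul_eq_zero.mp htS).resolve_left ht0)

end PatakiExtreme

/-! ### John's theorem (Theorem 6.5, KKT form for finite point sets) and Corollaries 6.6–6.8 -/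

section John

open Literature.LinearAlgebra.Matrix.NearestPositiveSemidefinite (trace_mul_nonneg)

variable {n : ℕ}

/-! #### Quadratic forms: continuity, bounds, a positive lower constant for positive definite matrices -/

/-- `xᵀ X x` as a double sum. [folklore] -/
private theorem dotProduct_mulVec_eq_sum (X : Matrix (Fin n) (Fin n) ℝ) (x y : Fin n → ℝ) :
    x ⬝ᵥ (X *ᵥ y) = ∑ a, ∑ b, X a b * x a * y b := by
  simp only [dotProduct, mulVec, Finset.mul_sum]
  exact Finset.sum_congr rfl fun a _ => Finset.sum_congr rfl fun b _ => by ring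

/-- `X ↦ xᵀ X y` is continuous. [folklore] -/
private theorem continuous_form (x y : Fin n → ℝ) :
    Continuous fun X : Fin n → Fin n → ℝ => x ⬝ᵥ (Matrix.of X *ᵥ y) := by
  have : (fun X : Fin n → Fin n → ℝ => x ⬝ᵥ (Matrix.of X *ᵥ y)) =
      fun X => ∑ a, ∑ b, X a b * x a * y b := by
    funext X
    rw [dotProduct_mulVec_eq_sum]
    rfl
  rw [this]
  fun_prop

/-- `|xᵀ H x| ≤ (Σ |H_{ab}|) · xᵀx`. [folklore] -/
private theorem abs_form_le (H : Matrix (Fin n) (Fin n) ℝ) (x : Fin n → ℝ) :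
    |x ⬝ᵥ (H *ᵥ x)| ≤ (∑ a, ∑ b, |H a b|) * (x ⬝ᵥ x) := by
  rw [dotProduct_mulVec_eq_sum]
  have hxx : ∀ a b, |x a * x b| ≤ x ⬝ᵥ x := by
    intro a b
    rw [abs_mul]
    have h1 : |x a| * |x b| ≤ (x a ^ 2 + x b ^ 2) / 2 := by
      nlinarith [sq_nonneg (|x a| - |x b|), sq_abs (x a), sq_abs (x b)]
    have h2 : x a ^ 2 + x b ^ 2 ≤ 2 * (x ⬝ᵥ x) := by
      by_cases hab : a = b
      · subst hab
        have : x a ^ 2 ≤ x ⬝ᵥ x := by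
          rw [dotProduct, ← Finset.sum_erase_add _ _ (Finset.mem_univ a), sq]
          have : 0 ≤ ∑ c ∈ Finset.univ.erase a, x c * x c :=
            Finset.sum_nonneg fun c _ => mul_self_nonneg (x c)
          linarith
        linarith
      · rw [dotProduct, ← Finset.sum_erase_add _ _ (Finset.mem_univ a),
          ← Finset.sum_erase_add _ _ (Finset.mem_erase.mpr ⟨Ne.symm hab, Finset.mem_univ b⟩)]
        have : 0 ≤ ∑ c ∈ (Finset.univ.erase a).erase b, x c * x c :=
          Finset.sum_nonneg fun c _ => mul_self_nonneg (x c)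
        nlinarith
    linarith
  calc |∑ a, ∑ b, H a b * x a * x b| ≤ ∑ a, |∑ b, H a b * x a * x b| := Finset.abs_sum_le_sum_abs _ _
    _ ≤ ∑ a, ∑ b, |H a b| * (x ⬝ᵥ x) := by
        refine Finset.sum_le_sum fun a _ => (Finset.abs_sum_le_sum_abs _ _).trans
          (Finset.sum_le_sum fun b _ => ?_)
        rw [mul_assoc, abs_mul]
        exact mul_le_mul_of_nonneg_left (hxx a b) (abs_nonneg _)
    _ = (∑ a, ∑ b, |H a b|) * (x ⬝ᵥ x) := by rw [Finset.sum_mul]; simp_rw [Finset.sum_mul]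

/-- A positive definite real matrix is bounded below by a positive multiple of the identity:
`λ · xᵀx ≤ xᵀ W x` (minimum of the form on the compact unit sphere of the sup norm). [folklore] -/
private theorem exists_form_ge_of_posDef {W : Matrix (Fin n) (Fin n) ℝ} (hW : W.PosDef) :
    ∃ lam : ℝ, 0 < lam ∧ ∀ x : Fin n → ℝ, lam * (x ⬝ᵥ x) ≤ x ⬝ᵥ (W *ᵥ x) := by
  classical
  rcases Nat.eq_zero_or_pos n with hn | hn
  · subst hn
    exact ⟨1, one_pos, fun x => by simp [dotProduct]⟩
  -- the sup-norm unit sphere is compact and nonempty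
  set S : Set (Fin n → ℝ) := Metric.sphere 0 1 with hS
  have hSc : IsCompact S := isCompact_sphere 0 1
  have hSne : S.Nonempty := by
    refine ⟨fun _ => 1, ?_⟩
    rw [hS, mem_sphere_zero_iff_norm]
    haveI : Nonempty (Fin n) := ⟨⟨0, hn⟩⟩
    simp [Pi.norm_def, Finset.sup_const Finset.univ_nonempty]
  have hcont : ContinuousOn (fun x : Fin n → ℝ => x ⬝ᵥ (W *ᵥ x)) S := by
    have : (fun x : Fin n → ℝ => x ⬝ᵥ (W *ᵥ x)) = fun x => ∑ a, ∑ b, W a b * x a * x b := by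
      funext x; rw [dotProduct_mulVec_eq_sum]
    rw [this]
    fun_prop
  obtain ⟨x₀, hx₀S, hmin⟩ := hSc.exists_isMinOn hSne hcont
  have hx₀ne : x₀ ≠ 0 := by
    intro h
    rw [h, hS, mem_sphere_zero_iff_norm, norm_zero] at hx₀S
    exact zero_ne_one hx₀S
  set lam0 : ℝ := x₀ ⬝ᵥ (W *ᵥ x₀) with hlam0
  have hlam0pos : 0 < lam0 := by
    have := hW.dotProduct_mulVec_pos hx₀ne
    rwa [star_trivial] at this
  -- on the sphere the form is `≥ lam0`; in general `≥ lam0 ‖x‖² ≥ (lam0/n) xᵀx`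
  refine ⟨lam0 / n, div_pos hlam0pos (by exact_mod_cast hn), fun x => ?_⟩
  by_cases hx : x = 0
  · subst hx; simp
  have hxn : 0 < ‖x‖ := norm_pos_iff.mpr hx
  set y : Fin n → ℝ := ‖x‖⁻¹ • x with hy
  have hyS : y ∈ S := by
    rw [hS, mem_sphere_zero_iff_norm, hy, norm_smul, norm_inv, norm_norm, inv_mul_cancel₀ hxn.ne']
  have hfy : lam0 ≤ y ⬝ᵥ (W *ᵥ y) := hmin hyS
  have hscale : y ⬝ᵥ (W *ᵥ y) = ‖x‖⁻¹ ^ 2 * (x ⬝ᵥ (W *ᵥ x)) := by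
    rw [hy, mulVec_smul, dotProduct_smul, smul_dotProduct, smul_eq_mul, smul_eq_mul]
    ring
  have hxx : x ⬝ᵥ x ≤ n * ‖x‖ ^ 2 := by
    calc x ⬝ᵥ x = ∑ a, x a * x a := rfl
      _ ≤ ∑ _a : Fin n, ‖x‖ ^ 2 := Finset.sum_le_sum fun a _ => by
          have h1 : |x a| ≤ ‖x‖ := by
            have := norm_le_pi_norm x a
            rwa [Real.norm_eq_abs] at this
          nlinarith [abs_nonneg (x a), sq_abs (x a)]
      _ = n * ‖x‖ ^ 2 := by simp
  have hnpos : (0 : ℝ) < n := by exact_mod_cast hn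
  rw [hscale] at hfy
  have h2 : lam0 * ‖x‖ ^ 2 ≤ x ⬝ᵥ (W *ᵥ x) := by
    have := mul_le_mul_of_nonneg_left hfy (sq_nonneg ‖x‖)
    rw [← mul_assoc, ← mul_pow, mul_inv_cancel₀ hxn.ne', one_pow, one_mul] at this
    linarith
  calc lam0 / n * (x ⬝ᵥ x) ≤ lam0 / n * (n * ‖x‖ ^ 2) :=
        mul_le_mul_of_nonneg_left hxx (div_nonneg hlam0pos.le hnpos.le)
    _ = lam0 * ‖x‖ ^ 2 := by field_simp
    _ ≤ x ⬝ᵥ (W *ᵥ x) := h2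

/-- The Gram-type matrix `W = Σ_i u_i u_iᵀ` of a spanning family is positive definite. [folklore] -/
private theorem posDef_sum_vecMulVec [Fintype ι] (u : ι → (Fin n → ℝ))
    (hspan : Submodule.span ℝ (Set.range u) = ⊤) :
    (∑ i, vecMulVec (u i) (u i)).PosDef := by
  classical
  have hpsd : (∑ i, vecMulVec (u i) (u i)).PosSemidef :=
    posSemidef_sum _ fun i _ => by simpa using posSemidef_vecMulVec_self_star (u i)
  refine PosDef.of_dotProduct_mulVec_pos hpsd.isHermitian fun x hx => ?_
  rw [star_trivial]
  have hform : x ⬝ᵥ ((∑ i, vecMulVec (u i) (u i)) *ᵥ x) = ∑ i, (u i ⬝ᵥ x) ^ 2 := by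
    rw [sum_mulVec, dotProduct_sum]
    refine Finset.sum_congr rfl fun i _ => ?_
    have : vecMulVec (u i) (u i) *ᵥ x = (u i ⬝ᵥ x) • u i := by
      ext a
      simp [vecMulVec_apply, mulVec, dotProduct, Finset.mul_sum, mul_comm, mul_left_comm]
    rw [this, dotProduct_smul, smul_eq_mul, sq, dotProduct_comm]
  rw [hform]
  -- if all `⟨u_i, x⟩ = 0` then `x ⊥ span = ⊤`, so `x = 0`
  by_contra hle
  push Not at hle
  have hall : ∀ i, u i ⬝ᵥ x = 0 := by
    intro i
    have hnn : ∀ j ∈ (Finset.univ : Finset ι), 0 ≤ (u j ⬝ᵥ x) ^ 2 := fun j _ => sq_nonneg _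
    have h0 : ∑ j, (u j ⬝ᵥ x) ^ 2 = 0 := le_antisymm hle (Finset.sum_nonneg hnn)
    exact pow_eq_zero_iff (n := 2) (by norm_num) |>.mp ((Finset.sum_eq_zero_iff_of_nonneg hnn).mp h0 i
      (Finset.mem_univ i))
  have hxmem : x ∈ Submodule.span ℝ (Set.range u) := by rw [hspan]; exact Submodule.mem_top
  have hperp : ∀ w ∈ Submodule.span ℝ (Set.range u), w ⬝ᵥ x = 0 := by
    intro w hw
    induction hw using Submodule.span_induction with
    | mem w hw =>
      obtain ⟨i, rfl⟩ := hw
      exact hall i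
    | zero => simp
    | add w w' _ _ hw hw' => rw [add_dotProduct, hw, hw', add_zero]
    | smul c w _ hw => rw [smul_dotProduct, hw, smul_zero]
  have hxx : x ⬝ᵥ x = 0 := hperp x hxmem
  exact hx (dotProduct_self_eq_zero.mp hxx)

/-! #### The feasible set of the maximal-determinant program is compact -/

/-- The set `{X ⪰ 0 : u_iᵀ X u_i ≤ 1 ∀ i}` of the max-det program (8.11)-dual (inscribed-ellipsoid form of
the minimum-volume ellipsoid problem for `±u_i`) is compact when the `u_i` span.
[cite: FawziEtAl2015, Thm. 6.5 (p18)] -/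
private theorem isCompact_feasible [Fintype ι] (u : ι → (Fin n → ℝ))
    (hspan : Submodule.span ℝ (Set.range u) = ⊤) :
    IsCompact {X : Fin n → Fin n → ℝ | (Matrix.of X).PosSemidef ∧ ∀ i, u i ⬝ᵥ (Matrix.of X *ᵥ u i) ≤ 1} := by
  classical
  apply Metric.isCompact_of_isClosed_isBounded
  · -- closed
    have h1 : IsClosed {X : Fin n → Fin n → ℝ | (Matrix.of X).PosSemidef} := by
      have : {X : Fin n → Fin n → ℝ | (Matrix.of X).PosSemidef} =
          (⋂ a, ⋂ b, {X : Fin n → Fin n → ℝ | X b a = X a b}) ∩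
            ⋂ x : Fin n → ℝ, {X | 0 ≤ x ⬝ᵥ (Matrix.of X *ᵥ x)} := by
        ext X
        simp only [Set.mem_setOf_eq, Set.mem_inter_iff, Set.mem_iInter, posSemidef_iff_dotProduct_mulVec,
          star_trivial]
        constructor
        · rintro ⟨hH, hq⟩
          refine ⟨fun a b => ?_, hq⟩
          have := congrFun (congrFun hH a) b
          simpa [conjTranspose_apply] using this
        · rintro ⟨hs, hq⟩
          refine ⟨?_, hq⟩
          ext a b
          simpa [conjTranspose_apply] using hs a b
      rw [this]
      refine IsClosed.inter (isClosed_iInter fun a => isClosed_iInter fun b => ?_)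
        (isClosed_iInter fun x => isClosed_le continuous_const (continuous_form x x))
      exact isClosed_eq (by fun_prop) (by fun_prop)
    have h2 : IsClosed (⋂ i, {X : Fin n → Fin n → ℝ | u i ⬝ᵥ (Matrix.of X *ᵥ u i) ≤ 1}) :=
      isClosed_iInter fun i => isClosed_le (continuous_form (u i) (u i)) continuous_const
    have : {X : Fin n → Fin n → ℝ | (Matrix.of X).PosSemidef ∧ ∀ i, u i ⬝ᵥ (Matrix.of X *ᵥ u i) ≤ 1} =
        {X : Fin n → Fin n → ℝ | (Matrix.of X).PosSemidef} ∩
          ⋂ i, {X : Fin n → Fin n → ℝ | u i ⬝ᵥ (Matrix.of X *ᵥ u i) ≤ 1} := by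
      ext X; simp [Set.mem_iInter]
    rw [this]
    exact h1.inter h2
  · -- bounded: `tr X ≤ m / λ` where `Σ u_iu_iᵀ ⪰ λ I`, and `|X_ab| ≤ tr X`
    obtain ⟨lam, hlam, hW⟩ := exists_form_ge_of_posDef (posDef_sum_vecMulVec u hspan)
    rw [isBounded_iff_forall_norm_le]
    refine ⟨Fintype.card ι / lam, fun X hX => ?_⟩
    obtain ⟨hXpsd, hXle⟩ := hX
    have hsym : ∀ a b, X b a = X a b := fun a b => by
      have := congrFun (congrFun hXpsd.1 a) b
      simpa [conjTranspose_apply] using this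
    have hq : ∀ x : Fin n → ℝ, 0 ≤ x ⬝ᵥ (Matrix.of X *ᵥ x) := fun x => by
      simpa using hXpsd.dotProduct_mulVec_nonneg x
    -- `λ · tr X ≤ Σ_i u_iᵀ X u_i ≤ m`
    have htrace : lam * ∑ a, X a a ≤ Fintype.card ι := by
      have hWpsd : (∑ i, vecMulVec (u i) (u i) - lam • (1 : Matrix (Fin n) (Fin n) ℝ)).PosSemidef := by
        have hWpsd' : (∑ i, vecMulVec (u i) (u i)).PosSemidef :=
          posSemidef_sum _ fun i _ => by simpa using posSemidef_vecMulVec_self_star (u i)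
        refine PosSemidef.of_dotProduct_mulVec_nonneg ?_ fun x => ?_
        · have h1 := hWpsd'.isHermitian
          unfold IsHermitian at h1 ⊢
          rw [conjTranspose_sub, h1, conjTranspose_smul, conjTranspose_one, star_trivial]
        · rw [star_trivial, sub_mulVec, dotProduct_sub, Matrix.smul_mulVec, one_mulVec, dotProduct_smul,
            smul_eq_mul]
          linarith [hW x]
      have h1 : 0 ≤ ((Matrix.of X) * (∑ i, vecMulVec (u i) (u i) - lam • 1)).trace :=
        trace_mul_nonneg hXpsd hWpsd
      have h2 : ((Matrix.of X) * (∑ i, vecMulVec (u i) (u i) - lam • 1)).trace =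
          ∑ i, u i ⬝ᵥ (Matrix.of X *ᵥ u i) - lam * ∑ a, X a a := by
        rw [Matrix.mul_sub, trace_sub, Matrix.mul_sum, trace_sum, Matrix.mul_smul, Matrix.mul_one,
          trace_smul, smul_eq_mul]
        congr 1
        refine Finset.sum_congr rfl fun i _ => ?_
        rw [dotProduct_mulVec_eq_sum]
        simp only [trace, diag_apply, mul_apply, vecMulVec_apply, of_apply]
        rw [Finset.sum_comm]
        exact Finset.sum_congr rfl fun a _ => Finset.sum_congr rfl fun b _ => by
          rw [hsym]; ring
      have h3 : ∑ i, u i ⬝ᵥ (Matrix.of X *ᵥ u i) ≤ Fintype.card ι := by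
        calc ∑ i, u i ⬝ᵥ (Matrix.of X *ᵥ u i) ≤ ∑ _i : ι, (1 : ℝ) := Finset.sum_le_sum fun i _ => hXle i
          _ = Fintype.card ι := by simp
      linarith
    have htr : ∑ a, X a a ≤ Fintype.card ι / lam := by
      rw [le_div_iff₀ hlam]; linarith
    have hdiag : ∀ a, 0 ≤ X a a := fun a => by
      have := hq (Pi.single a 1)
      simpa [dotProduct_mulVec_eq_sum, Pi.single_apply] using this
    have hdiag_le : ∀ a, X a a ≤ ∑ c, X c c := fun a =>
      Finset.single_le_sum (fun c _ => hdiag c) (Finset.mem_univ a)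
    have hentry : ∀ a b, |X a b| ≤ Fintype.card ι / lam := by
      intro a b
      by_cases hab : a = b
      · subst hab
        rw [abs_of_nonneg (hdiag a)]
        exact (hdiag_le a).trans htr
      · -- `(e_a ± e_b)ᵀ X (e_a ± e_b) ≥ 0` gives `|X_ab| ≤ (X_aa + X_bb)/2`
        have hp := hq (Pi.single a 1 + Pi.single b 1)
        have hm := hq (Pi.single a 1 - Pi.single b 1)
        rw [dotProduct_mulVec_eq_sum] at hp hm
        simp only [Matrix.of_apply] at hp hm
        have ep : ∑ c, ∑ d, X c d * (Pi.single a 1 + Pi.single b 1 : Fin n → ℝ) c *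
            (Pi.single a 1 + Pi.single b 1 : Fin n → ℝ) d = X a a + X a b + X b a + X b b := by
          simp [Pi.single_apply, Finset.sum_add_distrib, mul_add, Finset.sum_ite_eq']
          ring
        have em : ∑ c, ∑ d, X c d * (Pi.single a 1 - Pi.single b 1 : Fin n → ℝ) c *
            (Pi.single a 1 - Pi.single b 1 : Fin n → ℝ) d = X a a - X a b - X b a + X b b := by
          simp [Pi.single_apply, Finset.sum_sub_distrib, mul_sub, Finset.sum_ite_eq']
          ring
        rw [ep] at hp
        rw [em] at hm
        rw [hsym a b] at hp hm
        have h1 : |X a b| ≤ (X a a + X b b) / 2 := by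
          rw [abs_le]; constructor <;> linarith
        have h2 : X a a + X b b ≤ ∑ c, X c c := by
          rw [← Finset.sum_erase_add _ _ (Finset.mem_univ a),
            ← Finset.sum_erase_add _ _ (Finset.mem_erase.mpr ⟨Ne.symm hab, Finset.mem_univ b⟩)]
          have : 0 ≤ ∑ c ∈ (Finset.univ.erase a).erase b, X c c := Finset.sum_nonneg fun c _ => hdiag c
          linarith
        have h3 : 0 ≤ ∑ c, X c c := Finset.sum_nonneg fun c _ => hdiag c
        linarith [h1, h2, htr]
    have hR : 0 ≤ (Fintype.card ι : ℝ) / lam := div_nonneg (Nat.cast_nonneg _) hlam.le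
    rw [pi_norm_le_iff_of_nonneg hR]
    intro a
    rw [pi_norm_le_iff_of_nonneg hR]
    intro b
    rw [Real.norm_eq_abs]
    exact hentry a b

/-! #### John's theorem in KKT form (finite point sets) -/

/-- `tr (X · v vᵀ) = vᵀ X v`. [folklore] -/
private theorem trace_mul_vecMulVec (X : Matrix (Fin n) (Fin n) ℝ) (v : Fin n → ℝ) :
    (X * vecMulVec v v).trace = v ⬝ᵥ (X *ᵥ v) := by
  rw [dotProduct_mulVec_eq_sum]
  simp only [trace, diag_apply, mul_apply, vecMulVec_apply]
  exact Finset.sum_congr rfl fun a _ => Finset.sum_congr rfl fun b _ => by ring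

/-- A real polynomial is bounded on `[0, 1]` by the sum of the absolute values of its coefficients.
[folklore] -/
private theorem abs_eval_le (p : Polynomial ℝ) {δ : ℝ} (h0 : 0 ≤ δ) (h1 : δ ≤ 1) :
    |p.eval δ| ≤ ∑ i ∈ Finset.range (p.natDegree + 1), |p.coeff i| := by
  rw [Polynomial.eval_eq_sum_range]
  refine (Finset.abs_sum_le_sum_abs _ _).trans (Finset.sum_le_sum fun i _ => ?_)
  rw [abs_mul, abs_pow, abs_of_nonneg h0]
  exact mul_le_of_le_one_right (abs_nonneg _) (pow_le_one₀ h0 h1)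

/-- **John's theorem for a finite spanning family, Lagrangian (KKT) form.** For `u₁,…,u_m` spanning
`ℝⁿ` there is a positive definite `X` with `u_iᵀ X u_i ≤ 1` (the ellipsoid `{z : zᵀ X⁻¹ z ≤ 1}`
contains all `± u_i`) and multipliers `λ_i ≥ 0`, supported on the contact points `u_iᵀ X u_i = 1`,
with `X⁻¹ = Σ_i λ_i u_i u_iᵀ` and `Σ_i λ_i = n`.  This is the optimality condition of the
maximal-determinant (minimum-volume-ellipsoid) program behind Theorem 6.5; the proof maximises
`det` over the compact feasible set and derives the multipliers from Farkas' lemma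
(`LPDuality.farkas_nonneg_eq`) applied to a first-order perturbation `X + δH`.
[cite: FawziEtAl2015, Thm. 6.5 (p18); John 1948] -/
theorem exists_john_position [Fintype ι] (u : ι → (Fin n → ℝ))
    (hspan : Submodule.span ℝ (Set.range u) = ⊤) :
    ∃ X : Matrix (Fin n) (Fin n) ℝ, X.PosDef ∧ (∀ i, u i ⬝ᵥ (X *ᵥ u i) ≤ 1) ∧
      ∃ lam : ι → ℝ, 0 ≤ lam ∧ (∀ i, lam i ≠ 0 → u i ⬝ᵥ (X *ᵥ u i) = 1) ∧
        X⁻¹ = ∑ i, lam i • vecMulVec (u i) (u i) ∧ ∑ i, lam i = n := by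
  classical
  -- the feasible set and a strictly feasible point
  set S : Set (Fin n → Fin n → ℝ) :=
    {X | (Matrix.of X).PosSemidef ∧ ∀ i, u i ⬝ᵥ (Matrix.of X *ᵥ u i) ≤ 1} with hS_def
  have hSc : IsCompact S := isCompact_feasible u hspan
  have hnn : ∀ i, 0 ≤ u i ⬝ᵥ u i := fun i => by
    unfold dotProduct; exact Finset.sum_nonneg fun a _ => mul_self_nonneg _
  have hsum_nn : 0 ≤ ∑ i, u i ⬝ᵥ u i := Finset.sum_nonneg fun i _ => hnn i
  set ε : ℝ := 1 / (1 + ∑ i, u i ⬝ᵥ u i) with hε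
  have hεpos : 0 < ε := div_pos one_pos (by linarith)
  have hεle : ∀ i, ε * (u i ⬝ᵥ u i) ≤ 1 := by
    intro i
    have hi : u i ⬝ᵥ u i ≤ ∑ j, u j ⬝ᵥ u j :=
      Finset.single_le_sum (fun j _ => hnn j) (Finset.mem_univ i)
    rw [hε, div_mul_eq_mul_div, one_mul, div_le_one (by linarith)]
    linarith
  let X₀ : Fin n → Fin n → ℝ := ε • (1 : Matrix (Fin n) (Fin n) ℝ)
  have hX₀ : Matrix.of X₀ = ε • (1 : Matrix (Fin n) (Fin n) ℝ) := rfl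
  have hX₀S : X₀ ∈ S := by
    refine ⟨?_, fun i => ?_⟩
    · rw [hX₀]; exact PosSemidef.one.smul hεpos.le
    · rw [hX₀, Matrix.smul_mulVec, one_mulVec, dotProduct_smul, smul_eq_mul]; exact hεle i
  -- maximise the determinant over `S`
  have hcont : ContinuousOn (fun X : Fin n → Fin n → ℝ => (Matrix.of X).det) S :=
    (Continuous.matrix_det (A := fun X : Fin n → Fin n → ℝ => Matrix.of X) continuous_id).continuousOn
  obtain ⟨Xs, hXsS, hmax⟩ := hSc.exists_isMaxOn ⟨X₀, hX₀S⟩ hcont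
  set Xm : Matrix (Fin n) (Fin n) ℝ := Matrix.of Xs with hXm_def
  have hXm_psd : Xm.PosSemidef := hXsS.1
  have hXm_le : ∀ i, u i ⬝ᵥ (Xm *ᵥ u i) ≤ 1 := hXsS.2
  have hdet_ge : ε ^ n ≤ Xm.det := by
    have h := isMaxOn_iff.mp hmax X₀ hX₀S
    rw [hX₀, det_smul, det_one, mul_one, Fintype.card_fin] at h
    exact h
  have hdet_pos : 0 < Xm.det := lt_of_lt_of_le (pow_pos hεpos n) hdet_ge
  have hXm : Xm.PosDef := hXm_psd.posDef_iff_det_ne_zero.mpr hdet_pos.ne'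
  have hunit : IsUnit Xm.det := hdet_pos.ne'.isUnit
  set G : Matrix (Fin n) (Fin n) ℝ := Xm⁻¹ with hG_def
  have hGpsd : G.PosSemidef := hXm.inv.posSemidef
  have hGsym : ∀ a b, G b a = G a b := fun a b => by
    have := congrFun (congrFun hGpsd.1 a) b
    simpa [conjTranspose_apply] using this
  -- the Farkas system for the multipliers
  let A : Matrix ((Fin n × Fin n) ⊕ ι) ι ℝ := Matrix.of
    (Sum.elim (fun ab : Fin n × Fin n => fun i : ι => u i ab.1 * u i ab.2)
      (fun i' : ι => fun i : ι => if i = i' ∧ u i' ⬝ᵥ (Xm *ᵥ u i') ≠ 1 then (1 : ℝ) else 0))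
  let bvec : (Fin n × Fin n) ⊕ ι → ℝ :=
    Sum.elim (fun ab : Fin n × Fin n => G ab.1 ab.2) (fun _ => 0)
  have hfarkas : ∃ x : ι → ℝ, 0 ≤ x ∧ A *ᵥ x = bvec := by
    refine (Literature.Analysis.Convex.LPDuality.farkas_nonneg_eq A bvec).2 fun y hy => ?_
    set T : ι → ℝ := fun i => ∑ a, ∑ b, y (Sum.inl (a, b)) * (u i a * u i b) with hT_def
    have hyA : ∀ i, (y ᵥ* A) i = T i + (if u i ⬝ᵥ (Xm *ᵥ u i) ≠ 1 then y (Sum.inr i) else 0) := by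
      intro i
      simp only [A, vecMul, dotProduct, Matrix.of_apply, Fintype.sum_sum_type, Sum.elim_inl,
        Sum.elim_inr, Fintype.sum_prod_type, hT_def]
      congr 1
      rw [Finset.sum_eq_single i (fun j _ hj => by simp [Ne.symm hj])
        (fun h => (h (Finset.mem_univ i)).elim)]
      simp
    have hyb : y ⬝ᵥ bvec = ∑ a, ∑ b, y (Sum.inl (a, b)) * G a b := by
      simp only [bvec, dotProduct, Fintype.sum_sum_type, Sum.elim_inl, Sum.elim_inr, mul_zero,
        Finset.sum_const_zero, add_zero, Fintype.sum_prod_type]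
    by_contra hneg
    push Not at hneg
    -- the symmetric perturbation direction `H = -(Y + Yᵀ)/2`
    set H : Matrix (Fin n) (Fin n) ℝ :=
      Matrix.of fun a b => -((y (Sum.inl (a, b)) + y (Sum.inl (b, a))) / 2) with hH_def
    have hHsym : ∀ a b, H b a = H a b := fun a b => by
      simp only [hH_def, Matrix.of_apply]; ring
    have hHform : ∀ i, u i ⬝ᵥ (H *ᵥ u i) = -T i := by
      intro i
      rw [dotProduct_mulVec_eq_sum]
      have hswap : ∑ a, ∑ b, y (Sum.inl (b, a)) * (u i a * u i b) = T i := by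
        simp only [hT_def]
        rw [Finset.sum_comm]
        exact Finset.sum_congr rfl fun a _ => Finset.sum_congr rfl fun b _ => by ring
      have : ∀ a b, H a b * u i a * u i b = -(1 / 2) * (y (Sum.inl (a, b)) * (u i a * u i b)) +
          -(1 / 2) * (y (Sum.inl (b, a)) * (u i a * u i b)) := by
        intro a b; simp only [hH_def, Matrix.of_apply]; ring
      simp_rw [this, Finset.sum_add_distrib, ← Finset.mul_sum, hswap]
      simp only [hT_def]; ring
    have htrace : (G * H).trace = -(y ⬝ᵥ bvec) := by
      rw [hyb]
      simp only [trace, diag_apply, mul_apply]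
      have hswap : ∑ a, ∑ b, y (Sum.inl (b, a)) * G a b = ∑ a, ∑ b, y (Sum.inl (a, b)) * G a b := by
        rw [Finset.sum_comm]
        exact Finset.sum_congr rfl fun a _ => Finset.sum_congr rfl fun b _ => by rw [hGsym]
      have : ∀ a b, G a b * H b a = -(1 / 2) * (y (Sum.inl (a, b)) * G a b) +
          -(1 / 2) * (y (Sum.inl (b, a)) * G a b) := by
        intro a b; simp only [hH_def, Matrix.of_apply]; ring
      simp_rw [this, Finset.sum_add_distrib, ← Finset.mul_sum, hswap]
      ring
    have htrace_pos : 0 < (G * H).trace := by rw [htrace]; linarith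
    have hcontact : ∀ i, u i ⬝ᵥ (Xm *ᵥ u i) = 1 → u i ⬝ᵥ (H *ᵥ u i) ≤ 0 := by
      intro i hi
      have h := hy i
      rw [Pi.zero_apply, hyA i] at h
      simp [hi] at h
      rw [hHform]; linarith
    -- step sizes
    obtain ⟨μ, hμ, hμle⟩ := exists_form_ge_of_posDef hXm
    set B : ℝ := ∑ a, ∑ b, |H a b| with hB_def
    have hB0 : 0 ≤ B := Finset.sum_nonneg fun a _ => Finset.sum_nonneg fun b _ => abs_nonneg _
    set t : ι → ℝ := fun i => if u i ⬝ᵥ (Xm *ᵥ u i) = 1 then 1 else 1 - u i ⬝ᵥ (Xm *ᵥ u i)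
      with ht_def
    have htpos : ∀ i, 0 < t i := by
      intro i
      simp only [ht_def]
      split_ifs with h
      · exact one_pos
      · have := lt_of_le_of_ne (hXm_le i) h; linarith
    set h : ι → ℝ := fun i => u i ⬝ᵥ (H *ᵥ u i) with hh_def
    set K : ℝ := ∑ i, (|h i| + 1) / t i with hK_def
    have hK : 0 ≤ K := Finset.sum_nonneg fun i _ => div_nonneg (by positivity) (htpos i).le
    set δ₁ : ℝ := 1 / (1 + K) with hδ₁_def
    have hδ₁pos : 0 < δ₁ := div_pos one_pos (by linarith)
    have hδ₁le : ∀ i, δ₁ * (|h i| + 1) ≤ t i := by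
      intro i
      have h1 : (|h i| + 1) / t i ≤ K :=
        Finset.single_le_sum (f := fun j => (|h j| + 1) / t j)
          (fun j _ => div_nonneg (by positivity) (htpos j).le) (Finset.mem_univ i)
      have h2 : δ₁ * ((|h i| + 1) / t i) ≤ 1 := by
        rw [hδ₁_def, div_mul_eq_mul_div, one_mul, div_le_one (by linarith)]
        linarith
      have := mul_le_mul_of_nonneg_right h2 (htpos i).le
      rwa [mul_assoc, div_mul_cancel₀ _ (htpos i).ne', one_mul] at this
    set δ₂ : ℝ := μ / (B + 1) with hδ₂_def
    have hδ₂pos : 0 < δ₂ := div_pos hμ (by linarith)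
    have hδ₂B : δ₂ * B ≤ μ := by
      rw [hδ₂_def, div_mul_eq_mul_div, div_le_iff₀ (by linarith)]
      nlinarith [hμ.le, hB0]
    obtain ⟨p, hp⟩ : ∃ p : Polynomial ℝ, ∀ r : ℝ,
        (1 + r • (G * H)).det = 1 + (G * H).trace * r + p.eval r * r ^ 2 :=
      ⟨_, fun r => Matrix.det_one_add_smul r (G * H)⟩
    set Bp : ℝ := ∑ i ∈ Finset.range (p.natDegree + 1), |p.coeff i| with hBp_def
    have hBp0 : 0 ≤ Bp := Finset.sum_nonneg fun i _ => abs_nonneg _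
    set τ : ℝ := (G * H).trace with hτ_def
    set δ₃ : ℝ := τ / (2 * (Bp + 1)) with hδ₃_def
    have hδ₃pos : 0 < δ₃ := div_pos htrace_pos (by linarith)
    have hδ₃Bp : δ₃ * Bp ≤ τ / 2 := by
      rw [hδ₃_def, div_mul_eq_mul_div, div_le_iff₀ (by linarith)]
      nlinarith [htrace_pos.le, hBp0]
    set δ : ℝ := min (min δ₁ δ₂) (min δ₃ 1) with hδ_def
    have hδpos : 0 < δ := lt_min (lt_min hδ₁pos hδ₂pos) (lt_min hδ₃pos one_pos)
    have hδ1 : δ ≤ δ₁ := (min_le_left _ _).trans (min_le_left _ _)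
    have hδ2 : δ ≤ δ₂ := (min_le_left _ _).trans (min_le_right _ _)
    have hδ3 : δ ≤ δ₃ := (min_le_right _ _).trans (min_le_left _ _)
    have hδone : δ ≤ 1 := (min_le_right _ _).trans (min_le_right _ _)
    -- the perturbed matrix is feasible …
    set Xδ : Matrix (Fin n) (Fin n) ℝ := Xm + δ • H with hXδ_def
    have hof : Matrix.of (Xδ : Fin n → Fin n → ℝ) = Xδ := rfl
    have hXδS : (Xδ : Fin n → Fin n → ℝ) ∈ S := by
      refine ⟨?_, fun i => ?_⟩
      · rw [hof]
        refine PosSemidef.of_dotProduct_mulVec_nonneg ?_ fun x => ?_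
        · have h1 := hXm_psd.1
          unfold IsHermitian at h1 ⊢
          rw [hXδ_def, conjTranspose_add, conjTranspose_smul, star_trivial, h1]
          congr 1
          ext a b
          simp only [Matrix.smul_apply, conjTranspose_apply, star_trivial, smul_eq_mul]
          rw [hHsym a b]
        · rw [star_trivial, hXδ_def, add_mulVec, dotProduct_add, Matrix.smul_mulVec, dotProduct_smul,
            smul_eq_mul]
          have h1 := hμle x
          have h2 := abs_form_le H x
          have hxx : 0 ≤ x ⬝ᵥ x := by
            unfold dotProduct; exact Finset.sum_nonneg fun a _ => mul_self_nonneg _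
          have h3 : δ * |x ⬝ᵥ (H *ᵥ x)| ≤ μ * (x ⬝ᵥ x) := by
            calc δ * |x ⬝ᵥ (H *ᵥ x)| ≤ δ₂ * (B * (x ⬝ᵥ x)) :=
                  mul_le_mul hδ2 h2 (abs_nonneg _) hδ₂pos.le
              _ = δ₂ * B * (x ⬝ᵥ x) := by ring
              _ ≤ μ * (x ⬝ᵥ x) := mul_le_mul_of_nonneg_right hδ₂B hxx
          have h4 : -(δ * |x ⬝ᵥ (H *ᵥ x)|) ≤ δ * (x ⬝ᵥ (H *ᵥ x)) := by
            rw [← mul_neg]; exact mul_le_mul_of_nonneg_left (neg_abs_le _) hδpos.le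
          linarith
      · rw [hof, hXδ_def, add_mulVec, dotProduct_add, Matrix.smul_mulVec, dotProduct_smul, smul_eq_mul]
        by_cases hi : u i ⬝ᵥ (Xm *ᵥ u i) = 1
        · have := hcontact i hi
          nlinarith [hδpos.le]
        · have hti : t i = 1 - u i ⬝ᵥ (Xm *ᵥ u i) := by simp only [ht_def, if_neg hi]
          have h1 := hδ₁le i
          rw [hti] at h1
          have h2 : δ * (u i ⬝ᵥ (H *ᵥ u i)) ≤ δ₁ * (|h i| + 1) := by
            calc δ * (u i ⬝ᵥ (H *ᵥ u i)) ≤ δ * |h i| :=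
                  mul_le_mul_of_nonneg_left (le_abs_self (h i)) hδpos.le
              _ ≤ δ₁ * |h i| := mul_le_mul_of_nonneg_right hδ1 (abs_nonneg _)
              _ ≤ δ₁ * (|h i| + 1) := by nlinarith [hδ₁pos.le]
          linarith
    -- … but has a larger determinant
    have hdetδ : Xm.det < Xδ.det := by
      have hfac : Xδ = Xm * (1 + δ • (G * H)) := by
        rw [hXδ_def, Matrix.mul_add, Matrix.mul_one, Matrix.mul_smul, hG_def, ← Matrix.mul_assoc,
          Matrix.mul_nonsing_inv _ hunit, Matrix.one_mul]
      rw [hfac, det_mul, hp δ]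
      have hpe : |p.eval δ| ≤ Bp := abs_eval_le p hδpos.le hδone
      have h1 : -(τ / 2) ≤ p.eval δ * δ := by
        have h5 : -(Bp * δ) ≤ p.eval δ * δ := by
          rw [← neg_mul]; exact mul_le_mul_of_nonneg_right (neg_le_of_abs_le hpe) hδpos.le
        have h6 : Bp * δ ≤ τ / 2 := by
          calc Bp * δ ≤ Bp * δ₃ := mul_le_mul_of_nonneg_left hδ3 hBp0
            _ = δ₃ * Bp := mul_comm _ _
            _ ≤ τ / 2 := hδ₃Bp
        linarith
      have h2 : 1 < 1 + τ * δ + p.eval δ * δ ^ 2 := by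
        have : 0 < δ * (τ + p.eval δ * δ) := mul_pos hδpos (by linarith)
        nlinarith
      calc Xm.det = Xm.det * 1 := (mul_one _).symm
        _ < Xm.det * (1 + (G * H).trace * δ + p.eval δ * δ ^ 2) := mul_lt_mul_of_pos_left h2 hdet_pos
    have hle := isMaxOn_iff.mp hmax _ hXδS
    change Xδ.det ≤ Xm.det at hle
    exact absurd hle (not_le.mpr hdetδ)
  obtain ⟨lam, hlam0, hAlam⟩ := hfarkas
  have hrow1 : ∀ a b, ∑ i, lam i * (u i a * u i b) = G a b := by
    intro a b
    have := congrFun hAlam (Sum.inl (a, b))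
    simp only [A, bvec, mulVec, dotProduct, Matrix.of_apply, Sum.elim_inl] at this
    rw [← this]
    exact Finset.sum_congr rfl fun i _ => mul_comm _ _
  have hrow2 : ∀ i, lam i ≠ 0 → u i ⬝ᵥ (Xm *ᵥ u i) = 1 := by
    intro i hi
    by_contra hne
    have h1 : (A *ᵥ lam) (Sum.inr i) =
        ∑ j, (if j = i ∧ u i ⬝ᵥ (Xm *ᵥ u i) ≠ 1 then (1 : ℝ) else 0) * lam j := rfl
    have h2 := congrFun hAlam (Sum.inr i)
    rw [h1] at h2
    change _ = (0 : ℝ) at h2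
    rw [Finset.sum_eq_single i (fun j _ hj => by simp [hj]) (fun h => (h (Finset.mem_univ i)).elim)]
      at h2
    simp [hne] at h2
    exact hi h2
  have hGsum : G = ∑ i, lam i • vecMulVec (u i) (u i) := by
    ext a b
    rw [← hrow1 a b, Matrix.sum_apply]
    exact Finset.sum_congr rfl fun i _ => by simp [vecMulVec_apply, Matrix.smul_apply]
  refine ⟨Xm, hXm, hXm_le, lam, hlam0, hrow2, hGsum, ?_⟩
  -- `Σ λ_i = tr(X X⁻¹) = n`
  have h1 : (Xm * G).trace = n := by
    rw [hG_def, Matrix.mul_nonsing_inv _ hunit, trace_one, Fintype.card_fin]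
  have h2 : (Xm * G).trace = ∑ i, lam i := by
    rw [hGsum, Matrix.mul_sum, trace_sum]
    refine Finset.sum_congr rfl fun i _ => ?_
    rw [Matrix.mul_smul, trace_smul, smul_eq_mul, trace_mul_vecMulVec]
    by_cases hi : lam i = 0
    · rw [hi, zero_mul]
    · rw [hrow2 i hi, mul_one]
  exact h2.symm.trans h1

/-! #### Corollary 6.6 for finite families and Corollary 6.7 -/

/-- `(A x)·(B y) = xᵀ (Aᵀ B) y`. [folklore] -/
private theorem mulVec_dotProduct_mulVec (A B : Matrix (Fin n) (Fin n) ℝ) (x y : Fin n → ℝ) :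
    (A *ᵥ x) ⬝ᵥ (B *ᵥ y) = x ⬝ᵥ ((Aᵀ * B) *ᵥ y) := by
  rw [← mulVec_mulVec, dotProduct_mulVec x Aᵀ, vecMul_transpose]

/-- `vᵀ (Σ λ_i u_i u_iᵀ) v = Σ λ_i (u_i·v)²`. [folklore] -/
private theorem form_sum_smul_vecMulVec [Fintype ι] (lam : ι → ℝ)
    (u : ι → (Fin n → ℝ)) (v : Fin n → ℝ) :
    v ⬝ᵥ ((∑ i, lam i • vecMulVec (u i) (u i)) *ᵥ v) = ∑ i, lam i * (u i ⬝ᵥ v) ^ 2 := by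
  rw [sum_mulVec, dotProduct_sum]
  refine Finset.sum_congr rfl fun i _ => ?_
  have : vecMulVec (u i) (u i) *ᵥ v = (u i ⬝ᵥ v) • u i := by
    ext a
    simp [vecMulVec_apply, mulVec, dotProduct, Finset.mul_sum, mul_comm, mul_left_comm]
  rw [Matrix.smul_mulVec, this, dotProduct_smul, dotProduct_smul, smul_eq_mul, smul_eq_mul, sq,
    dotProduct_comm v (u i)]

/-- **Corollary 6.6 for finite families.** If `u_i` (`i ∈ ι`) span `ℝⁿ` (`n ≥ 1`), `Δ > 0` and
`|u_iᵀ v_j| ≤ Δ` for all `i, j`, then some invertible `L` has `‖L u_i‖₂ ≤ n^{1/4}√Δ` and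
`‖L⁻ᵀ v_j‖₂ ≤ n^{1/4}√Δ` for all `i, j`: take `L = n^{1/4}√Δ · X^{1/2}` for the John position `X`
of `exists_john_position`; then `‖L u‖² = √n Δ · uᵀXu ≤ √n Δ` and
`‖L⁻ᵀ v‖² = (√n Δ)⁻¹ Σ λ_i (u_iᵀv)² ≤ (√n Δ)⁻¹ · nΔ²`.
[cite: FawziEtAl2015, Cor. 6.6 (p19)] -/
theorem exists_rescaling_of_abs_dotProduct_le [Fintype ι] (hn : 1 ≤ n)
    (u : ι → (Fin n → ℝ)) (v : κ → (Fin n → ℝ)) (hspan : Submodule.span ℝ (Set.range u) = ⊤)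
    {Δ : ℝ} (hΔ : 0 < Δ) (huv : ∀ i j, |u i ⬝ᵥ v j| ≤ Δ) :
    ∃ L : Matrix (Fin n) (Fin n) ℝ, IsUnit L.det ∧
      (∀ i, Real.sqrt ((L *ᵥ u i) ⬝ᵥ (L *ᵥ u i)) ≤ (n : ℝ) ^ ((1 : ℝ) / 4) * Real.sqrt Δ) ∧
      ∀ j, Real.sqrt ((L⁻¹ᵀ *ᵥ v j) ⬝ᵥ (L⁻¹ᵀ *ᵥ v j)) ≤ (n : ℝ) ^ ((1 : ℝ) / 4) * Real.sqrt Δ := by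
  classical
  obtain ⟨X, hX, hXle, lam, hlam0, -, hXinv, hsum⟩ := exists_john_position u hspan
  -- `R = X^{1/2}`
  set R : Matrix (Fin n) (Fin n) ℝ := CFC.sqrt X with hR
  have hRpsd : R.PosSemidef := (CFC.sqrt_nonneg X).posSemidef
  have hRR : R * R = X := CFC.sqrt_mul_sqrt_self X hX.posSemidef.nonneg
  have hRsymm : Rᵀ = R := by
    have h := hRpsd.1.eq
    rwa [conjTranspose_eq_transpose_of_trivial] at h
  have hRdet : IsUnit R.det := by
    have hXdet : X.det ≠ 0 := hX.det_pos.ne'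
    rw [← hRR, det_mul] at hXdet
    exact isUnit_iff_ne_zero.2 fun h0 => hXdet (by rw [h0, mul_zero])
  -- the scaling constant `c = n^{1/4} √Δ`, `c⁴ = n Δ²`
  set c : ℝ := (n : ℝ) ^ ((1 : ℝ) / 4) * Real.sqrt Δ with hc
  have hnpos : (0 : ℝ) < n := by exact_mod_cast hn
  have hcpos : 0 < c := mul_pos (Real.rpow_pos_of_pos hnpos _) (Real.sqrt_pos.mpr hΔ)
  have hn4 : ((n : ℝ) ^ ((1 : ℝ) / 4)) ^ 4 = n := by
    rw [← Real.rpow_mul_natCast hnpos.le]; norm_num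
  have hs4 : Real.sqrt Δ ^ 4 = Δ ^ 2 := by
    rw [show (4 : ℕ) = 2 * 2 from rfl, pow_mul, Real.sq_sqrt hΔ.le]
  have hc4 : c ^ 4 = n * Δ ^ 2 := by rw [hc, mul_pow, hn4, hs4]
  set L : Matrix (Fin n) (Fin n) ℝ := c • R with hL
  have hLdet : IsUnit L.det := by
    rw [hL, det_smul, Fintype.card_fin]
    exact (hcpos.ne'.isUnit.pow n).mul hRdet
  have hLinv : L⁻¹ = c⁻¹ • R⁻¹ := by
    refine Matrix.inv_eq_left_inv ?_
    rw [hL, Matrix.smul_mul, Matrix.mul_smul, Matrix.nonsing_inv_mul _ hRdet, smul_smul,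
      inv_mul_cancel₀ hcpos.ne', one_smul]
  have hLinvT : L⁻¹ᵀ = c⁻¹ • R⁻¹ := by
    rw [hLinv, transpose_smul, transpose_nonsing_inv, hRsymm]
  have hRinv2 : R⁻¹ᵀ * R⁻¹ = X⁻¹ := by
    rw [transpose_nonsing_inv, hRsymm, ← Matrix.mul_inv_rev, hRR]
  refine ⟨L, hLdet, fun i => ?_, fun j => ?_⟩
  · -- `‖L u_i‖² = c² u_iᵀ X u_i ≤ c²`
    have h1 : (L *ᵥ u i) ⬝ᵥ (L *ᵥ u i) = c ^ 2 * (u i ⬝ᵥ (X *ᵥ u i)) := by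
      rw [hL, Matrix.smul_mulVec, smul_dotProduct, dotProduct_smul, smul_eq_mul, smul_eq_mul,
        mulVec_dotProduct_mulVec, hRsymm, hRR]
      ring
    have h2 : (L *ᵥ u i) ⬝ᵥ (L *ᵥ u i) ≤ c ^ 2 := by
      rw [h1]
      nlinarith [hXle i, sq_nonneg c]
    calc Real.sqrt ((L *ᵥ u i) ⬝ᵥ (L *ᵥ u i)) ≤ Real.sqrt (c ^ 2) := Real.sqrt_le_sqrt h2
      _ = c := Real.sqrt_sq hcpos.le
  · -- `‖L⁻ᵀ v_j‖² = c⁻² v_jᵀ X⁻¹ v_j = c⁻² Σ λ_i (u_iᵀ v_j)² ≤ c⁻² n Δ² = c²`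
    have h1 : (L⁻¹ᵀ *ᵥ v j) ⬝ᵥ (L⁻¹ᵀ *ᵥ v j) = c⁻¹ ^ 2 * ∑ i, lam i * (u i ⬝ᵥ v j) ^ 2 := by
      rw [hLinvT, Matrix.smul_mulVec, smul_dotProduct, dotProduct_smul, smul_eq_mul, smul_eq_mul,
        mulVec_dotProduct_mulVec, hRinv2, hXinv, form_sum_smul_vecMulVec]
      ring
    have h2 : ∑ i, lam i * (u i ⬝ᵥ v j) ^ 2 ≤ n * Δ ^ 2 := by
      calc ∑ i, lam i * (u i ⬝ᵥ v j) ^ 2 ≤ ∑ i, lam i * Δ ^ 2 :=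
            Finset.sum_le_sum fun i _ => mul_le_mul_of_nonneg_left
              (by rw [← sq_abs]; exact pow_le_pow_left₀ (abs_nonneg _) (huv i j) 2) (hlam0 i)
        _ = n * Δ ^ 2 := by rw [← Finset.sum_mul, hsum]
    have h3 : (L⁻¹ᵀ *ᵥ v j) ⬝ᵥ (L⁻¹ᵀ *ᵥ v j) ≤ c ^ 2 := by
      rw [h1]
      have h4 : c⁻¹ ^ 2 * (n * Δ ^ 2) = c ^ 2 := by
        rw [← hc4]; field_simp
      calc c⁻¹ ^ 2 * ∑ i, lam i * (u i ⬝ᵥ v j) ^ 2 ≤ c⁻¹ ^ 2 * (n * Δ ^ 2) :=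
            mul_le_mul_of_nonneg_left h2 (sq_nonneg _)
        _ = c ^ 2 := h4
    calc Real.sqrt ((L⁻¹ᵀ *ᵥ v j) ⬝ᵥ (L⁻¹ᵀ *ᵥ v j)) ≤ Real.sqrt (c ^ 2) := Real.sqrt_le_sqrt h3
      _ = c := Real.sqrt_sq hcpos.le

/-- **Corollary 6.7 — DISCHARGED** (`FawziEtAl2015_cor67_holds : FawziEtAl2015_cor67`).  A rank-`k`
matrix with entries bounded by `Δ` in absolute value factors as `M_{ij} = ⟨a_i, b_j⟩`, `a_i, b_j ∈ ℝ^k`,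
with `‖a_i‖₂, ‖b_j‖₂ ≤ k^{1/4}√Δ`: take any rank factorisation (here through a basis of the column
space of `M`) and rescale it with `exists_rescaling_of_abs_dotProduct_le` (Cor. 6.6, finite form,
from John's theorem `exists_john_position`). [cite: FawziEtAl2015, Cor. 6.7 (p19)] -/
theorem FawziEtAl2015_cor67_holds : FawziEtAl2015_cor67 := by
  intro ι κ _ _ M k Δ hrank hΔ
  classical
  rcases Nat.eq_zero_or_pos k with hk | hk
  · -- rank `0`: `M = 0`
    subst hk
    have hM : ∀ i j, M i j = 0 := by
      have h0 : LinearMap.range M.mulVecLin = ⊥ := by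
        rw [← Submodule.finrank_eq_zero]; exact hrank
      rw [LinearMap.range_eq_bot] at h0
      intro i j
      have := congrFun (LinearMap.congr_fun h0 (Pi.single j 1)) i
      simpa [mulVec, dotProduct, Pi.single_apply] using this
    exact ⟨fun _ _ => 0, fun _ _ => 0, fun i j => by simp [hM i j], fun i => by simp, fun j => by simp⟩
  · -- `Δ > 0` since `M ≠ 0`
    have hΔpos : 0 < Δ := by
      by_contra hle
      push Not at hle
      have hM0 : M = 0 := by
        ext i j
        exact abs_nonpos_iff.mp ((hΔ i j).trans hle)
      rw [hM0, Matrix.rank_zero] at hrank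
      omega
    -- rank factorisation `M = B V` through a basis of the column space
    set W : Submodule ℝ (ι → ℝ) := LinearMap.range M.mulVecLin with hW
    have hWk : Module.finrank ℝ W = k := hrank
    let bW : Module.Basis (Fin k) ℝ W := Module.finBasisOfFinrankEq ℝ W hWk
    have hcol : ∀ j, (fun i => M i j) ∈ W := fun j =>
      ⟨Pi.single j 1, by ext i; simp [mulVec, dotProduct, Pi.single_apply]⟩
    let Bm : Matrix ι (Fin k) ℝ := Matrix.of fun i l => ((bW l : W) : ι → ℝ) i
    let V : κ → (Fin k → ℝ) := fun j => bW.repr ⟨fun i => M i j, hcol j⟩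
    have hMBV : ∀ i j, Bm.row i ⬝ᵥ V j = M i j := by
      intro i j
      have h := bW.sum_repr ⟨fun i => M i j, hcol j⟩
      have h' := congrArg (fun w : W => (w : ι → ℝ) i) h
      simp only [AddSubmonoidClass.coe_finsetSum, SetLike.val_smul, Finset.sum_apply, Pi.smul_apply,
        smul_eq_mul] at h'
      rw [← h']
      simp only [Matrix.row, dotProduct, Bm, Matrix.of_apply, V]
      exact Finset.sum_congr rfl fun l _ => mul_comm _ _
    -- the rows of `B` span `ℝ^k` (its columns are linearly independent)
    have hli : LinearIndependent ℝ (fun l => ((bW l : W) : ι → ℝ)) :=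
      bW.linearIndependent.map' W.subtype W.ker_subtype
    have hrankB : Bm.rank = k := by
      rw [Matrix.rank_eq_finrank_span_cols]
      have : Bm.col = fun l => ((bW l : W) : ι → ℝ) := rfl
      rw [this, finrank_span_eq_card hli, Fintype.card_fin]
    have hspanB : Submodule.span ℝ (Set.range Bm.row) = ⊤ := by
      apply Submodule.eq_top_of_finrank_eq
      rw [← Matrix.rank_eq_finrank_span_row, hrankB, Module.finrank_fin_fun]
    obtain ⟨L, hL, hLu, hLv⟩ := exists_rescaling_of_abs_dotProduct_le (n := k) hk Bm.row V hspanB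
      hΔpos (fun i j => by rw [hMBV i j]; exact hΔ i j)
    have hsq : ∀ w : Fin k → ℝ, ∑ l, w l ^ 2 = w ⬝ᵥ w := fun w => by simp [dotProduct, sq]
    refine ⟨fun i => L *ᵥ Bm.row i, fun j => L⁻¹ᵀ *ᵥ V j, fun i j => ?_, fun i => ?_, fun j => ?_⟩
    · change M i j = (L *ᵥ Bm.row i) ⬝ᵥ (L⁻¹ᵀ *ᵥ V j)
      rw [mulVec_dotProduct_mulVec, ← transpose_mul, Matrix.nonsing_inv_mul _ hL, transpose_one,
        one_mulVec, hMBV]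
    · rw [hsq]; exact hLu i
    · rw [hsq]; exact hLv j

/-! #### Corollary 6.6 for bounded (possibly infinite) sets: compactness extension -/

/-- `√x ≤ c ⇒ x ≤ c²` for `x ≥ 0`. [folklore] -/
private theorem le_sq_of_sqrt_le {x c : ℝ} (hx : 0 ≤ x) (h : Real.sqrt x ≤ c) : x ≤ c ^ 2 := by
  have := pow_le_pow_left₀ (Real.sqrt_nonneg x) h 2
  rwa [Real.sq_sqrt hx] at this

/-- `0 ≤ yᵀy`. [folklore] -/
private theorem dotProduct_self_nonneg' (y : Fin n → ℝ) : 0 ≤ y ⬝ᵥ y := by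
  unfold dotProduct; exact Finset.sum_nonneg fun a _ => mul_self_nonneg _

/-- `|y_a| ≤ c` when `‖y‖₂² ≤ c²`. [folklore] -/
private theorem abs_apply_le_of_dotProduct_le {y : Fin n → ℝ} {c : ℝ} (hc : 0 ≤ c)
    (h : y ⬝ᵥ y ≤ c ^ 2) (a : Fin n) : |y a| ≤ c := by
  have h1 : y a ^ 2 ≤ y ⬝ᵥ y := by
    unfold dotProduct
    rw [sq]
    exact Finset.single_le_sum (f := fun j => y j * y j) (fun j _ => mul_self_nonneg (y j))
      (Finset.mem_univ a)
  calc |y a| ≤ Real.sqrt (y ⬝ᵥ y) := Real.abs_le_sqrt h1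
    _ ≤ Real.sqrt (c ^ 2) := Real.sqrt_le_sqrt h
    _ = c := Real.sqrt_sq hc

/-- Entries of `L` are controlled by `‖L w_x‖₂ ≤ c` on a spanning family `w_x` (through the
coefficients `α` of the standard basis vectors in that family). [folklore] -/
private theorem abs_entry_le {ι' : Type*} [Fintype ι'] (w : ι' → (Fin n → ℝ)) (α : Fin n → ι' → ℝ)
    (hα : ∀ b, ∑ x, α b x • w x = Pi.single b 1) (L : Matrix (Fin n) (Fin n) ℝ) {c : ℝ}
    (hc : 0 ≤ c) (hL : ∀ x, (L *ᵥ w x) ⬝ᵥ (L *ᵥ w x) ≤ c ^ 2) (a b : Fin n) :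
    |L a b| ≤ c * ∑ b', ∑ x, |α b' x| := by
  classical
  have hab : L a b = ∑ x, α b x * (L *ᵥ w x) a := by
    have h1 : L a b = (L *ᵥ Pi.single b 1) a := by
      simp [mulVec, dotProduct, Pi.single_apply]
    rw [h1, ← hα b]
    simp only [mulVec, dotProduct, Finset.sum_apply, Pi.smul_apply, smul_eq_mul, Finset.mul_sum]
    rw [Finset.sum_comm]
    exact Finset.sum_congr rfl fun x _ => Finset.sum_congr rfl fun j _ => by ring
  rw [hab]
  calc |∑ x, α b x * (L *ᵥ w x) a| ≤ ∑ x, |α b x * (L *ᵥ w x) a| := Finset.abs_sum_le_sum_abs _ _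
    _ ≤ ∑ x, |α b x| * c := Finset.sum_le_sum fun x _ => by
        rw [abs_mul]
        exact mul_le_mul_of_nonneg_left (abs_apply_le_of_dotProduct_le hc (hL x) a) (abs_nonneg _)
    _ = c * ∑ x, |α b x| := by rw [← Finset.sum_mul, mul_comm]
    _ ≤ c * ∑ b', ∑ x, |α b' x| := mul_le_mul_of_nonneg_left
        (Finset.single_le_sum (f := fun b' => ∑ x, |α b' x|)
          (fun b' _ => Finset.sum_nonneg fun x _ => abs_nonneg _) (Finset.mem_univ b)) hc

/-- `L ↦ ‖L u‖₂²` is continuous. [folklore] -/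
private theorem continuous_quad (u : Fin n → ℝ) :
    Continuous fun L : Fin n → Fin n → ℝ => (Matrix.of L *ᵥ u) ⬝ᵥ (Matrix.of L *ᵥ u) := by
  show Continuous fun L : Fin n → Fin n → ℝ => ∑ a, (∑ b, L a b * u b) * (∑ b, L a b * u b)
  fun_prop

/-- `L ↦ ‖Lᵀ v‖₂²` is continuous. [folklore] -/
private theorem continuous_quad_transpose (v : Fin n → ℝ) :
    Continuous fun L : Fin n → Fin n → ℝ => ((Matrix.of L)ᵀ *ᵥ v) ⬝ᵥ ((Matrix.of L)ᵀ *ᵥ v) := by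
  show Continuous fun L : Fin n → Fin n → ℝ => ∑ a, (∑ b, L b a * v b) * (∑ b, L b a * v b)
  fun_prop

/-- A set spanning `ℝⁿ`, `n ≥ 1`, has a non-zero element. [folklore] -/
private theorem exists_ne_zero_of_span_eq_top (hn : 1 ≤ n) {W : Set (Fin n → ℝ)}
    (hW : Submodule.span ℝ W = ⊤) : ∃ w ∈ W, w ≠ 0 := by
  by_contra h
  push Not at h
  have hle : Submodule.span ℝ W ≤ ⊥ := Submodule.span_le.mpr fun w hw => by simp [h w hw]
  rw [hW] at hle
  have hx : (fun _ => (1 : ℝ)) ∈ (⊥ : Submodule ℝ (Fin n → ℝ)) := hle Submodule.mem_top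
  rw [Submodule.mem_bot] at hx
  exact one_ne_zero (congrFun hx ⟨0, hn⟩)

/-- **Corollary 6.6 — DISCHARGED** (`FawziEtAl2015_cor66_holds : FawziEtAl2015_cor66`).  For bounded
spanning `U, V ⊆ ℝⁿ` with `|⟨u, v⟩| ≤ Δ` there is an invertible `L` with `‖Lu‖₂, ‖L⁻ᵀv‖₂ ≤ n^{1/4}√Δ`
on `U`, `V`.  Reduction to the finite form `exists_rescaling_of_abs_dotProduct_le` by compactness:
fix finite spanning `U₀ ⊆ U`, `V₀ ⊆ V`; the pairs `(L, L⁻¹)` satisfying the bounds on `U₀, V₀` form a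
compact set, on which the constraints indexed by `u ∈ U`, `v ∈ V` are closed and have the finite
intersection property (finite form applied to `U₀ ∪ F`, `V₀ ∪ F'`), hence a common point.
[cite: FawziEtAl2015, Cor. 6.6 (p19)] -/
theorem FawziEtAl2015_cor66_holds : FawziEtAl2015_cor66 := by
  intro n U V Δ _hUb _hVb hUspan hVspan hΔ
  classical
  rcases Nat.eq_zero_or_pos n with hn | hn
  · subst hn
    refine ⟨1, by simp, fun u _ => ?_, fun v _ => ?_⟩
    · have : ((1 : Matrix (Fin 0) (Fin 0) ℝ) *ᵥ u) ⬝ᵥ ((1 : Matrix (Fin 0) (Fin 0) ℝ) *ᵥ u) = 0 := by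
        simp [dotProduct]
      rw [this, Real.sqrt_zero]; positivity
    · have : ((1 : Matrix (Fin 0) (Fin 0) ℝ)⁻¹ᵀ *ᵥ v) ⬝ᵥ ((1 : Matrix (Fin 0) (Fin 0) ℝ)⁻¹ᵀ *ᵥ v) = 0 := by
        simp [dotProduct]
      rw [this, Real.sqrt_zero]; positivity
  -- `n ≥ 1`: `Δ > 0`
  obtain ⟨u₀, hu₀U, -⟩ := exists_ne_zero_of_span_eq_top hn hUspan
  obtain ⟨v₀, hv₀V, hv₀⟩ := exists_ne_zero_of_span_eq_top hn hVspan
  have hΔpos : 0 < Δ := by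
    by_contra hle
    push Not at hle
    have horth : ∀ u ∈ U, u ⬝ᵥ v₀ = 0 := fun u hu => abs_nonpos_iff.mp ((hΔ u hu v₀ hv₀V).trans hle)
    have hperp : ∀ w ∈ Submodule.span ℝ U, w ⬝ᵥ v₀ = 0 := by
      intro w hw
      induction hw using Submodule.span_induction with
      | mem w hw => exact horth w hw
      | zero => simp
      | add w w' _ _ hw hw' => rw [add_dotProduct, hw, hw', add_zero]
      | smul c w _ hw => rw [smul_dotProduct, hw, smul_zero]
    have := hperp v₀ (by rw [hUspan]; exact Submodule.mem_top)
    exact hv₀ (dotProduct_self_eq_zero.mp this)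
  -- finite spanning subsets
  obtain ⟨U₀, hU₀U, hU₀span, hU₀li⟩ := exists_linearIndependent ℝ U
  obtain ⟨V₀, hV₀V, hV₀span, hV₀li⟩ := exists_linearIndependent ℝ V
  haveI : Fintype U₀ := hU₀li.setFinite.fintype
  haveI : Fintype V₀ := hV₀li.setFinite.fintype
  have hU₀top : Submodule.span ℝ (Set.range (fun x : U₀ => (x : Fin n → ℝ))) = ⊤ := by
    rw [Subtype.range_coe, hU₀span, hUspan]
  have hV₀top : Submodule.span ℝ (Set.range (fun x : V₀ => (x : Fin n → ℝ))) = ⊤ := by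
    rw [Subtype.range_coe, hV₀span, hVspan]
  -- coefficients of the standard basis in the two finite spanning families
  choose αU hαU using fun b : Fin n =>
    (Submodule.mem_span_range_iff_exists_fun ℝ).mp
      (show Pi.single b (1 : ℝ) ∈ Submodule.span ℝ (Set.range (fun x : U₀ => (x : Fin n → ℝ))) by
        rw [hU₀top]; exact Submodule.mem_top)
  choose αV hαV using fun b : Fin n =>
    (Submodule.mem_span_range_iff_exists_fun ℝ).mp
      (show Pi.single b (1 : ℝ) ∈ Submodule.span ℝ (Set.range (fun x : V₀ => (x : Fin n → ℝ))) by
        rw [hV₀top]; exact Submodule.mem_top)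
  -- the constant and the compact parameter set of pairs `(L, L⁻¹)`
  set c : ℝ := (n : ℝ) ^ ((1 : ℝ) / 4) * Real.sqrt Δ with hc
  have hnpos : (0 : ℝ) < n := by exact_mod_cast hn
  have hc0 : 0 ≤ c := (mul_pos (Real.rpow_pos_of_pos hnpos _) (Real.sqrt_pos.mpr hΔpos)).le
  set K : Set ((Fin n → Fin n → ℝ) × (Fin n → Fin n → ℝ)) :=
    {p | Matrix.of p.1 * Matrix.of p.2 = 1} ∩
      ((⋂ u ∈ U₀, {p | (Matrix.of p.1 *ᵥ u) ⬝ᵥ (Matrix.of p.1 *ᵥ u) ≤ c ^ 2}) ∩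
        ⋂ v ∈ V₀, {p | ((Matrix.of p.2)ᵀ *ᵥ v) ⬝ᵥ ((Matrix.of p.2)ᵀ *ᵥ v) ≤ c ^ 2}) with hK_def
  have hKclosed : IsClosed K := by
    refine (isClosed_eq ?_ continuous_const).inter
      ((isClosed_biInter fun u _ => isClosed_le ((continuous_quad u).comp continuous_fst)
        continuous_const).inter
        (isClosed_biInter fun v _ => isClosed_le ((continuous_quad_transpose v).comp continuous_snd)
          continuous_const))
    exact Continuous.matrix_mul
      (A := fun p : (Fin n → Fin n → ℝ) × (Fin n → Fin n → ℝ) => Matrix.of p.1)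
      (B := fun p : (Fin n → Fin n → ℝ) × (Fin n → Fin n → ℝ) => Matrix.of p.2)
      continuous_fst continuous_snd
  have hKbdd : Bornology.IsBounded K := by
    rw [isBounded_iff_forall_norm_le]
    set RU : ℝ := c * ∑ b', ∑ x, |αU b' x| with hRU
    set RV : ℝ := c * ∑ b', ∑ x, |αV b' x| with hRV
    have hRU0 : 0 ≤ RU :=
      mul_nonneg hc0 (Finset.sum_nonneg fun _ _ => Finset.sum_nonneg fun _ _ => abs_nonneg _)
    have hRV0 : 0 ≤ RV :=
      mul_nonneg hc0 (Finset.sum_nonneg fun _ _ => Finset.sum_nonneg fun _ _ => abs_nonneg _)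
    refine ⟨max RU RV, fun p hp => ?_⟩
    obtain ⟨-, hpU, hpV⟩ := hp
    rw [Prod.norm_def, max_le_iff]
    constructor
    · refine le_trans ?_ (le_max_left _ _)
      rw [pi_norm_le_iff_of_nonneg hRU0]
      intro a
      rw [pi_norm_le_iff_of_nonneg hRU0]
      intro b
      rw [Real.norm_eq_abs]
      exact abs_entry_le (fun x : U₀ => (x : Fin n → ℝ)) αU hαU (Matrix.of p.1) hc0
        (fun x => Set.mem_iInter₂.mp hpU x.1 x.2) a b
    · refine le_trans ?_ (le_max_right _ _)
      rw [pi_norm_le_iff_of_nonneg hRV0]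
      intro a
      rw [pi_norm_le_iff_of_nonneg hRV0]
      intro b
      rw [Real.norm_eq_abs]
      exact abs_entry_le (fun x : V₀ => (x : Fin n → ℝ)) αV hαV (Matrix.of p.2)ᵀ hc0
        (fun x => Set.mem_iInter₂.mp hpV x.1 x.2) b a
  have hKc : IsCompact K := Metric.isCompact_of_isClosed_isBounded hKclosed hKbdd
  -- the closed constraints indexed by `U ⊕ V`
  set t : U ⊕ V → Set ((Fin n → Fin n → ℝ) × (Fin n → Fin n → ℝ)) :=
    Sum.elim (fun u => {p | (Matrix.of p.1 *ᵥ (u : Fin n → ℝ)) ⬝ᵥ (Matrix.of p.1 *ᵥ (u : Fin n → ℝ)) ≤ c ^ 2})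
      (fun v => {p | ((Matrix.of p.2)ᵀ *ᵥ (v : Fin n → ℝ)) ⬝ᵥ ((Matrix.of p.2)ᵀ *ᵥ (v : Fin n → ℝ))
        ≤ c ^ 2}) with ht_def
  have htc : ∀ i, IsClosed (t i) := by
    rintro (u | v)
    · exact isClosed_le ((continuous_quad _).comp continuous_fst) continuous_const
    · exact isClosed_le ((continuous_quad_transpose _).comp continuous_snd) continuous_const
  -- finite intersection property, from the finite form of Corollary 6.6
  have hfip : ∀ T : Finset (U ⊕ V), (K ∩ ⋂ i ∈ T, t i).Nonempty := by
    intro T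
    let uT : U₀ ⊕ T → (Fin n → ℝ) := Sum.elim (fun x => (x : Fin n → ℝ))
      (fun s => Sum.elim (fun u : U => (u : Fin n → ℝ)) (fun _ => u₀) s.1)
    let vT : V₀ ⊕ T → (Fin n → ℝ) := Sum.elim (fun x => (x : Fin n → ℝ))
      (fun s => Sum.elim (fun _ => v₀) (fun v : V => (v : Fin n → ℝ)) s.1)
    have huT : ∀ i, uT i ∈ U := by
      rintro (x | ⟨u | v, _⟩)
      exacts [hU₀U x.2, u.2, hu₀U]
    have hvT : ∀ j, vT j ∈ V := by
      rintro (x | ⟨u | v, _⟩)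
      exacts [hV₀V x.2, hv₀V, v.2]
    have hspanT : Submodule.span ℝ (Set.range uT) = ⊤ := by
      apply eq_top_iff.mpr
      rw [← hU₀top]
      apply Submodule.span_mono
      rintro _ ⟨x, rfl⟩
      exact ⟨Sum.inl x, rfl⟩
    obtain ⟨L, hLdet, hLu, hLv⟩ := exists_rescaling_of_abs_dotProduct_le hn uT vT hspanT hΔpos
      (fun i j => hΔ _ (huT i) _ (hvT j))
    have hq1 : ∀ i, (L *ᵥ uT i) ⬝ᵥ (L *ᵥ uT i) ≤ c ^ 2 := fun i =>
      le_sq_of_sqrt_le (dotProduct_self_nonneg' _) (hLu i)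
    have hq2 : ∀ j, (L⁻¹ᵀ *ᵥ vT j) ⬝ᵥ (L⁻¹ᵀ *ᵥ vT j) ≤ c ^ 2 := fun j =>
      le_sq_of_sqrt_le (dotProduct_self_nonneg' _) (hLv j)
    refine ⟨(Matrix.of.symm L, Matrix.of.symm L⁻¹), ⟨?_, ?_, ?_⟩, ?_⟩
    · show L * L⁻¹ = 1
      exact Matrix.mul_nonsing_inv L hLdet
    · refine Set.mem_iInter₂.mpr fun u hu => ?_
      show (L *ᵥ u) ⬝ᵥ (L *ᵥ u) ≤ c ^ 2
      exact hq1 (Sum.inl ⟨u, hu⟩)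
    · refine Set.mem_iInter₂.mpr fun v hv => ?_
      show (L⁻¹ᵀ *ᵥ v) ⬝ᵥ (L⁻¹ᵀ *ᵥ v) ≤ c ^ 2
      exact hq2 (Sum.inl ⟨v, hv⟩)
    · refine Set.mem_iInter₂.mpr fun i hi => ?_
      rcases i with u | v
      · show (L *ᵥ (u : Fin n → ℝ)) ⬝ᵥ (L *ᵥ (u : Fin n → ℝ)) ≤ c ^ 2
        exact hq1 (Sum.inr ⟨Sum.inl u, hi⟩)
      · show (L⁻¹ᵀ *ᵥ (v : Fin n → ℝ)) ⬝ᵥ (L⁻¹ᵀ *ᵥ (v : Fin n → ℝ)) ≤ c ^ 2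
        exact hq2 (Sum.inr ⟨Sum.inr v, hi⟩)
  -- a common point
  obtain ⟨p, hpK, hp⟩ := hKc.inter_iInter_nonempty t htc hfip
  obtain ⟨hp1, -, -⟩ := hpK
  have hLinv : (Matrix.of p.1)⁻¹ = Matrix.of p.2 := Matrix.inv_eq_right_inv hp1
  have hLdet : IsUnit (Matrix.of p.1).det := by
    have := congrArg Matrix.det hp1
    rw [det_mul, det_one] at this
    exact IsUnit.of_mul_eq_one _ this
  refine ⟨Matrix.of p.1, hLdet, fun u hu => ?_, fun v hv => ?_⟩
  · have h := Set.mem_iInter.mp hp (Sum.inl ⟨u, hu⟩)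
    change (Matrix.of p.1 *ᵥ u) ⬝ᵥ (Matrix.of p.1 *ᵥ u) ≤ c ^ 2 at h
    exact (Real.sqrt_le_sqrt h).trans_eq (Real.sqrt_sq hc0)
  · have h := Set.mem_iInter.mp hp (Sum.inr ⟨v, hv⟩)
    change ((Matrix.of p.2)ᵀ *ᵥ v) ⬝ᵥ ((Matrix.of p.2)ᵀ *ᵥ v) ≤ c ^ 2 at h
    rw [hLinv]
    exact (Real.sqrt_le_sqrt h).trans_eq (Real.sqrt_sq hc0)

/-! #### Corollary 6.8: the sharp rescaling of psd factorizations -/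

/-- Cauchy–Schwarz for the quadratic form of a psd matrix: `(zᵀAx)² ≤ (zᵀAz)(xᵀAx)`. [folklore] -/
private theorem form_cauchySchwarz {k : ℕ} {A : Matrix (Fin k) (Fin k) ℝ} (hA : A.PosSemidef)
    (x z : Fin k → ℝ) : (z ⬝ᵥ (A *ᵥ x)) ^ 2 ≤ (z ⬝ᵥ (A *ᵥ z)) * (x ⬝ᵥ (A *ᵥ x)) := by
  have hAt : Aᵀ = A := by simpa [conjTranspose_eq_transpose_of_trivial] using hA.1.eq
  have hsymm : x ⬝ᵥ (A *ᵥ z) = z ⬝ᵥ (A *ᵥ x) := by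
    rw [dotProduct_mulVec x A z, ← mulVec_transpose, hAt, dotProduct_comm]
  have hnn : ∀ a : Fin k → ℝ, 0 ≤ a ⬝ᵥ (A *ᵥ a) := fun a => by
    simpa using hA.dotProduct_mulVec_nonneg a
  rcases (hnn x).eq_or_lt with hq0 | hqpos
  · have hAx : A *ᵥ x = 0 := (hA.dotProduct_mulVec_zero_iff x).mp (by simpa using hq0.symm)
    rw [hAx, dotProduct_zero, dotProduct_zero]
    simp
  · have hqne : x ⬝ᵥ (A *ᵥ x) ≠ 0 := hqpos.ne'
    have h0 := hnn (z - ((z ⬝ᵥ (A *ᵥ x)) / (x ⬝ᵥ (A *ᵥ x))) • x)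
    have hexp : ∀ t : ℝ, (z - t • x) ⬝ᵥ (A *ᵥ (z - t • x)) =
        z ⬝ᵥ (A *ᵥ z) - 2 * t * (z ⬝ᵥ (A *ᵥ x)) + t ^ 2 * (x ⬝ᵥ (A *ᵥ x)) := by
      intro t
      simp only [mulVec_sub, mulVec_smul, sub_dotProduct, dotProduct_sub, smul_dotProduct,
        dotProduct_smul, smul_eq_mul]
      rw [hsymm]; ring
    rw [hexp] at h0
    have key : (z ⬝ᵥ (A *ᵥ x)) ^ 2 / (x ⬝ᵥ (A *ᵥ x)) ≤ z ⬝ᵥ (A *ᵥ z) := by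
      have e : z ⬝ᵥ (A *ᵥ z) - 2 * ((z ⬝ᵥ (A *ᵥ x)) / (x ⬝ᵥ (A *ᵥ x))) * (z ⬝ᵥ (A *ᵥ x)) +
          ((z ⬝ᵥ (A *ᵥ x)) / (x ⬝ᵥ (A *ᵥ x))) ^ 2 * (x ⬝ᵥ (A *ᵥ x)) =
          z ⬝ᵥ (A *ᵥ z) - (z ⬝ᵥ (A *ᵥ x)) ^ 2 / (x ⬝ᵥ (A *ᵥ x)) := by
        field_simp
        ring
      linarith
    rwa [div_le_iff₀ hqpos] at key

/-- `vecMulVec u u *ᵥ z = ⟨u, z⟩ u`. [folklore] -/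
private theorem vecMulVec_self_mulVec {k : ℕ} (u z : Fin k → ℝ) :
    vecMulVec u u *ᵥ z = (u ⬝ᵥ z) • u := by
  ext a
  simp [vecMulVec_apply, mulVec, dotProduct, Finset.mul_sum, mul_comm, mul_left_comm]

/-- The eigenvalue step of Cor. 6.8, done with quadratic forms: if `A ⪰ 0`, `A' = Q A Qᵀ`, `P Q = 1`
and `‖P u‖₂² ≤ c₂` for every `u` with `uuᵀ ⪯ A'`, then `A ⪯ c₂ I` (test `u = Q w`,
`w = A x / √(xᵀAx)`, for which `wwᵀ ⪯ A` by Cauchy–Schwarz).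
[cite: FawziEtAl2015, Cor. 6.8 proof (p19)] -/
private theorem posSemidef_smul_one_sub {k : ℕ} {A A' P Q : Matrix (Fin k) (Fin k) ℝ} {c₂ : ℝ}
    (hc₂ : 0 ≤ c₂) (hPQ : P * Q = 1) (hA'A : A' = Q * A * Qᵀ) (hA : A.PosSemidef)
    (hU : ∀ u, (A' - vecMulVec u u).PosSemidef → (P *ᵥ u) ⬝ᵥ (P *ᵥ u) ≤ c₂) :
    (c₂ • (1 : Matrix (Fin k) (Fin k) ℝ) - A).PosSemidef := by
  have hAt : Aᵀ = A := by simpa [conjTranspose_eq_transpose_of_trivial] using hA.1.eq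
  have hnn : ∀ a : Fin k → ℝ, 0 ≤ a ⬝ᵥ (A *ᵥ a) := fun a => by
    simpa using hA.dotProduct_mulVec_nonneg a
  refine PosSemidef.of_dotProduct_mulVec_nonneg ?_ fun x => ?_
  · have h1 := hA.1
    unfold IsHermitian at h1 ⊢
    rw [conjTranspose_sub, conjTranspose_smul, conjTranspose_one, star_trivial, h1]
  rw [star_trivial, sub_mulVec, Matrix.smul_mulVec, one_mulVec, dotProduct_sub, dotProduct_smul,
    smul_eq_mul, sub_nonneg]
  have hxx : 0 ≤ x ⬝ᵥ x := dotProduct_self_nonneg' x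
  rcases (hnn x).eq_or_lt with hq0 | hqpos
  · rw [← hq0]; exact mul_nonneg hc₂ hxx
  -- `w = (xᵀAx)^{-1/2} A x` has `(yᵀw)² ≤ yᵀAy` for all `y`
  set w : Fin k → ℝ := (Real.sqrt (x ⬝ᵥ (A *ᵥ x)))⁻¹ • (A *ᵥ x) with hw_def
  have hw : ∀ y, (y ⬝ᵥ w) ^ 2 ≤ y ⬝ᵥ (A *ᵥ y) := by
    intro y
    rw [hw_def, dotProduct_smul, smul_eq_mul, mul_pow, inv_pow, Real.sq_sqrt hqpos.le,
      inv_mul_le_iff₀ hqpos, mul_comm]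
    exact form_cauchySchwarz hA x y
  -- `u = Q w` is a test vector: `uuᵀ ⪯ A'`
  set u : Fin k → ℝ := Q *ᵥ w with hu_def
  have hu : (A' - vecMulVec u u).PosSemidef := by
    refine PosSemidef.of_dotProduct_mulVec_nonneg ?_ fun z => ?_
    · unfold IsHermitian
      rw [conjTranspose_sub, conjTranspose_eq_transpose_of_trivial,
        conjTranspose_eq_transpose_of_trivial, transpose_vecMulVec, hA'A, transpose_mul,
        transpose_mul, transpose_transpose, hAt, Matrix.mul_assoc]
    · rw [star_trivial, sub_mulVec, dotProduct_sub, sub_nonneg]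
      have e1 : z ⬝ᵥ (vecMulVec u u *ᵥ z) = (z ⬝ᵥ u) ^ 2 := by
        rw [vecMulVec_self_mulVec, dotProduct_smul, smul_eq_mul, sq, dotProduct_comm u z]
      have e2 : z ⬝ᵥ (A' *ᵥ z) = (Qᵀ *ᵥ z) ⬝ᵥ (A *ᵥ (Qᵀ *ᵥ z)) := by
        rw [hA'A, ← mulVec_mulVec, ← mulVec_mulVec, dotProduct_mulVec z Q, ← mulVec_transpose]
      have e3 : z ⬝ᵥ u = (Qᵀ *ᵥ z) ⬝ᵥ w := by
        rw [hu_def, dotProduct_mulVec z Q w, ← mulVec_transpose]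
      rw [e1, e2, e3]
      exact hw _
  have hPu : P *ᵥ u = w := by
    rw [hu_def, mulVec_mulVec, hPQ, one_mulVec]
  have hww : w ⬝ᵥ w ≤ c₂ := by
    have := hU u hu
    rwa [hPu] at this
  have hww' : w ⬝ᵥ w = (x ⬝ᵥ (A *ᵥ x))⁻¹ * ((A *ᵥ x) ⬝ᵥ (A *ᵥ x)) := by
    rw [hw_def, smul_dotProduct, dotProduct_smul, smul_eq_mul, smul_eq_mul, ← mul_assoc, ← mul_inv,
      Real.mul_self_sqrt hqpos.le]
  -- plain Cauchy–Schwarz `(xᵀAx)² ≤ ‖x‖² ‖Ax‖²`, and `‖Ax‖² = (xᵀAx) ‖w‖² ≤ (xᵀAx) c₂`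
  have hcs : (x ⬝ᵥ (A *ᵥ x)) ^ 2 ≤ (x ⬝ᵥ x) * ((A *ᵥ x) ⬝ᵥ (A *ᵥ x)) := by
    have := form_cauchySchwarz PosSemidef.one (A *ᵥ x) x
    simpa only [one_mulVec] using this
  have h1 : (A *ᵥ x) ⬝ᵥ (A *ᵥ x) ≤ (x ⬝ᵥ (A *ᵥ x)) * c₂ := by
    rw [hww', inv_mul_le_iff₀ hqpos] at hww
    exact hww
  have h2 : (x ⬝ᵥ (A *ᵥ x)) * (x ⬝ᵥ (A *ᵥ x)) ≤ (c₂ * (x ⬝ᵥ x)) * (x ⬝ᵥ (A *ᵥ x)) := by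
    have := hcs.trans (mul_le_mul_of_nonneg_left h1 hxx)
    rw [sq] at this
    linarith
  exact le_of_mul_le_mul_right h2 hqpos

/-- `u_a² ≤ tr X` when `uuᵀ ⪯ X`. [folklore] -/
private theorem sq_apply_le_trace {k : ℕ} {X : Matrix (Fin k) (Fin k) ℝ} {u : Fin k → ℝ}
    (hXu : (X - vecMulVec u u).PosSemidef) (a : Fin k) : u a ^ 2 ≤ X.trace := by
  have h1 : u a ^ 2 ≤ X a a := by
    have := hXu.diag_nonneg (i := a)
    simp only [Matrix.sub_apply, vecMulVec_apply] at this
    nlinarith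
  have hX : X.PosSemidef := by
    have := hXu.add (posSemidef_vecMulVec_self_star u)
    simpa using this
  exact h1.trans (Finset.single_le_sum (f := fun b => X b b) (fun b _ => hX.diag_nonneg)
    (Finset.mem_univ a))

/-- `⟨u, v⟩² ≤ tr(X Y)` when `uuᵀ ⪯ X` and `vvᵀ ⪯ Y ⪰ 0` (`⟨uuᵀ, vvᵀ⟩ ≤ ⟨X, Y⟩`). [folklore] -/
private theorem dotProduct_sq_le_trace {k : ℕ} {X Y : Matrix (Fin k) (Fin k) ℝ} {u v : Fin k → ℝ}
    (hXu : (X - vecMulVec u u).PosSemidef) (hYv : (Y - vecMulVec v v).PosSemidef)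
    (hY : Y.PosSemidef) : (u ⬝ᵥ v) ^ 2 ≤ (X * Y).trace := by
  have huu : (vecMulVec u u).PosSemidef := by simpa using posSemidef_vecMulVec_self_star u
  have hsplit : X * Y = (X - vecMulVec u u) * Y + vecMulVec u u * (Y - vecMulVec v v) +
      vecMulVec u u * vecMulVec v v := by
    rw [sub_mul, Matrix.mul_sub]; abel
  have htr : (vecMulVec u u * vecMulVec v v).trace = (u ⬝ᵥ v) ^ 2 := by
    rw [vecMulVec_mul_vecMulVec, trace_vecMulVec, dotProduct_smul, smul_eq_mul, sq]
  rw [hsplit, trace_add, trace_add, htr]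
  linarith [trace_mul_nonneg hXu hY, trace_mul_nonneg huu hYv]

/-- **Corollary 6.8 — DISCHARGED** (`FawziEtAl2015_cor68_holds : FawziEtAl2015_cor68`; the sharp
Briët–Dadush–Pokutta rescaling).  Following the printed proof: with a size-`k` psd factorization
`(A'_i, B'_j)` of `M ≤ Δ` put `U = {u : uuᵀ ⪯ A'_i some i}`, `V = {v : vvᵀ ⪯ B'_j some j}`; then
`⟨u,v⟩² ≤ ⟨A'_i, B'_j⟩ ≤ Δ`, Cor. 6.6 (`FawziEtAl2015_cor66_holds`) rescales by `L`, and
`A_i = L A'_i Lᵀ`, `B_j = L⁻ᵀ B'_j L⁻¹` have all Rayleigh quotients `≤ √(kΔ)`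
(`posSemidef_smul_one_sub`).  Deviation from the print: to make `U`, `V` span `ℝ^k` in the degenerate
case we adjoin the tiny vectors `ε e_a` to both (harmless for the pairing bound `√Δ`); `Δ ≤ 0` forces
`M = 0` and zero factors. [cite: FawziEtAl2015, Cor. 6.8 (p19)] -/
theorem FawziEtAl2015_cor68_holds : FawziEtAl2015_cor68 := by
  intro ι κ _ _ M k Δ hMΔ hfact
  classical
  obtain ⟨A', B', hA', hB', hM⟩ := hfact
  have hMnn : ∀ i j, 0 ≤ M i j := fun i j => by rw [hM]; exact trace_mul_nonneg (hA' i) (hB' j)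
  by_cases hΔ : 0 < Δ
  swap
  · push Not at hΔ
    have hM0 : ∀ i j, M i j = 0 := fun i j => le_antisymm ((hMΔ i j).trans hΔ) (hMnn i j)
    refine ⟨fun _ => 0, fun _ => 0, fun _ => PosSemidef.zero, fun _ => PosSemidef.zero,
      fun i j => by simp [hM0 i j], fun _ => ?_, fun _ => ?_⟩
    · rw [sub_zero]; exact PosSemidef.one.smul (Real.sqrt_nonneg _)
    · rw [sub_zero]; exact PosSemidef.one.smul (Real.sqrt_nonneg _)
  -- constants
  set s : ℝ := Real.sqrt Δ with hs
  have hspos : 0 < s := Real.sqrt_pos.mpr hΔ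
  set S : ℝ := ∑ i, (A' i).trace + ∑ j, (B' j).trace with hS_def
  have hS0 : 0 ≤ S := add_nonneg (Finset.sum_nonneg fun i _ => (hA' i).trace_nonneg)
    (Finset.sum_nonneg fun j _ => (hB' j).trace_nonneg)
  set ε : ℝ := s / ((1 + s) * (1 + S)) with hε
  have hεpos : 0 < ε := by positivity
  have hεS : ε * (1 + S) ≤ s := by
    rw [hε, div_mul_eq_mul_div, div_le_iff₀ (by positivity)]
    nlinarith [mul_nonneg (mul_nonneg hspos.le hspos.le) (by linarith : (0 : ℝ) ≤ 1 + S)]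
  have hεle : ε ≤ ε * (1 + S) := by nlinarith [hεpos.le, hS0]
  have hεle1 : ε ≤ 1 := by
    rw [hε, div_le_one (by positivity)]
    nlinarith [mul_nonneg hspos.le hS0, hS0]
  have hε2 : ε * ε ≤ s := by nlinarith [hεpos.le, hεle1, hεle, hεS]
  -- coordinate bounds on the test vectors
  have htrA : ∀ i, (A' i).trace ≤ S := fun i =>
    (Finset.single_le_sum (f := fun i => (A' i).trace) (fun i _ => (hA' i).trace_nonneg)
      (Finset.mem_univ i)).trans (le_add_of_nonneg_right (Finset.sum_nonneg fun j _ => (hB' j).trace_nonneg))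
  have htrB : ∀ j, (B' j).trace ≤ S := fun j =>
    (Finset.single_le_sum (f := fun j => (B' j).trace) (fun j _ => (hB' j).trace_nonneg)
      (Finset.mem_univ j)).trans (le_add_of_nonneg_left (Finset.sum_nonneg fun i _ => (hA' i).trace_nonneg))
  have hsqrtS : Real.sqrt S ≤ 1 + S := by
    calc Real.sqrt S ≤ Real.sqrt ((1 + S) ^ 2) := Real.sqrt_le_sqrt (by nlinarith)
      _ = 1 + S := Real.sqrt_sq (by linarith)
  have hcoordA : ∀ u i, (A' i - vecMulVec u u).PosSemidef → ∀ a, |u a| ≤ 1 + S := fun u i h a =>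
    (Real.abs_le_sqrt ((sq_apply_le_trace h a).trans (htrA i))).trans hsqrtS
  have hcoordB : ∀ v j, (B' j - vecMulVec v v).PosSemidef → ∀ a, |v a| ≤ 1 + S := fun v j h a =>
    (Real.abs_le_sqrt ((sq_apply_le_trace h a).trans (htrB j))).trans hsqrtS
  have hcoordE : ∀ a b : Fin k, |(ε • (Pi.single a 1 : Fin k → ℝ)) b| ≤ ε := by
    intro a b
    rw [Pi.smul_apply, smul_eq_mul, abs_mul, abs_of_pos hεpos]
    refine mul_le_of_le_one_right hεpos.le ?_
    by_cases hab : b = a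
    · subst hab; simp
    · simp [hab]
  -- the two sets
  set U : Set (Fin k → ℝ) := {u | ∃ i, (A' i - vecMulVec u u).PosSemidef} ∪
    Set.range (fun a : Fin k => ε • (Pi.single a 1 : Fin k → ℝ)) with hU_def
  set V : Set (Fin k → ℝ) := {v | ∃ j, (B' j - vecMulVec v v).PosSemidef} ∪
    Set.range (fun a : Fin k => ε • (Pi.single a 1 : Fin k → ℝ)) with hV_def
  have hUabs : ∀ u ∈ U, ∀ a, |u a| ≤ 1 + S := by
    rintro u (⟨i, hi⟩ | ⟨a, rfl⟩) b
    · exact hcoordA u i hi b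
    · exact (hcoordE a b).trans (hεle1.trans (by linarith))
  have hVabs : ∀ v ∈ V, ∀ a, |v a| ≤ 1 + S := by
    rintro v (⟨j, hj⟩ | ⟨a, rfl⟩) b
    · exact hcoordB v j hj b
    · exact (hcoordE a b).trans (hεle1.trans (by linarith))
  have hbdd : ∀ W : Set (Fin k → ℝ), (∀ w ∈ W, ∀ a, |w a| ≤ 1 + S) → Bornology.IsBounded W :=
    fun W hW => isBounded_iff_forall_norm_le.mpr ⟨1 + S, fun w hw =>
      (pi_norm_le_iff_of_nonneg (by linarith)).mpr fun a => by
        rw [Real.norm_eq_abs]; exact hW w hw a⟩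
  have hspan : ∀ W : Set (Fin k → ℝ), (∀ a, ε • (Pi.single a 1 : Fin k → ℝ) ∈ W) →
      Submodule.span ℝ W = ⊤ := by
    intro W hW
    apply eq_top_iff.mpr
    rw [← (Pi.basisFun ℝ (Fin k)).span_eq]
    apply Submodule.span_le.mpr
    rintro _ ⟨a, rfl⟩
    rw [Pi.basisFun_apply]
    have hmem : ε • (Pi.single a 1 : Fin k → ℝ) ∈ Submodule.span ℝ W := Submodule.subset_span (hW a)
    have := Submodule.smul_mem _ ε⁻¹ hmem
    rwa [smul_smul, inv_mul_cancel₀ hεpos.ne', one_smul] at this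
  have hUspan : Submodule.span ℝ U = ⊤ := hspan U fun a => Set.mem_union_right _ ⟨a, rfl⟩
  have hVspan : Submodule.span ℝ V = ⊤ := hspan V fun a => Set.mem_union_right _ ⟨a, rfl⟩
  -- the pairing bound `|⟨u, v⟩| ≤ √Δ`
  have hpair : ∀ u ∈ U, ∀ v ∈ V, |u ⬝ᵥ v| ≤ s := by
    rintro u (⟨i, hi⟩ | ⟨a, rfl⟩) v (⟨j, hj⟩ | ⟨b, rfl⟩)
    · refine Real.abs_le_sqrt ((dotProduct_sq_le_trace hi hj (hB' j)).trans ?_)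
      rw [← hM]; exact hMΔ i j
    · rw [dotProduct_smul, smul_eq_mul, dotProduct_single_one, abs_mul, abs_of_pos hεpos]
      exact (mul_le_mul_of_nonneg_left (hcoordA u i hi b) hεpos.le).trans hεS
    · rw [smul_dotProduct, smul_eq_mul, single_one_dotProduct, abs_mul, abs_of_pos hεpos]
      exact (mul_le_mul_of_nonneg_left (hcoordB v j hj a) hεpos.le).trans hεS
    · rw [smul_dotProduct, smul_eq_mul, single_one_dotProduct, abs_mul, abs_of_pos hεpos]
      exact (mul_le_mul_of_nonneg_left (hcoordE b a) hεpos.le).trans hε2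
  -- Corollary 6.6
  obtain ⟨L, hLdet, hLU, hLV⟩ :=
    FawziEtAl2015_cor66_holds k U V s (hbdd U hUabs) (hbdd V hVabs) hUspan hVspan hpair
  have hc2 : ((k : ℝ) ^ ((1 : ℝ) / 4) * Real.sqrt s) ^ 2 = Real.sqrt (k * Δ) := by
    rw [mul_pow, Real.sq_sqrt hspos.le, hs, Real.sqrt_mul (Nat.cast_nonneg k)]
    congr 1
    rw [Real.sqrt_eq_rpow, ← Real.rpow_mul_natCast (Nat.cast_nonneg k)]
    norm_num
  have hc2nn : 0 ≤ Real.sqrt (k * Δ) := Real.sqrt_nonneg _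
  set Li : Matrix (Fin k) (Fin k) ℝ := L⁻¹ with hLi
  have hLLi : L * Li = 1 := Matrix.mul_nonsing_inv L hLdet
  have hLiL : Li * L = 1 := Matrix.nonsing_inv_mul L hLdet
  have hT : Lᵀ * Liᵀ = 1 := by rw [← transpose_mul, hLiL, transpose_one]
  have hT' : Liᵀ * Lᵀ = 1 := by rw [← transpose_mul, hLLi, transpose_one]
  refine ⟨fun i => L * A' i * Lᵀ, fun j => Liᵀ * B' j * Li, fun i => ?_, fun j => ?_, fun i j => ?_,
    fun i => ?_, fun j => ?_⟩
  · have := (hA' i).mul_mul_conjTranspose_same L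
    rwa [conjTranspose_eq_transpose_of_trivial] at this
  · have := (hB' j).mul_mul_conjTranspose_same Liᵀ
    rwa [conjTranspose_eq_transpose_of_trivial, transpose_transpose] at this
  · rw [hM i j]
    calc (A' i * B' j).trace = (Li * (L * (A' i * B' j))).trace := by
          rw [← Matrix.mul_assoc, hLiL, Matrix.one_mul]
      _ = (L * (A' i * B' j) * Li).trace := Matrix.trace_mul_comm _ _
      _ = (L * A' i * Lᵀ * (Liᵀ * B' j * Li)).trace := by
          congr 1
          calc L * (A' i * B' j) * Li = L * (A' i * (Lᵀ * Liᵀ) * B' j) * Li := by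
                rw [hT, Matrix.mul_one]
            _ = L * A' i * Lᵀ * (Liᵀ * B' j * Li) := by simp only [Matrix.mul_assoc]
  · refine posSemidef_smul_one_sub hc2nn hLLi (A' := A' i) ?_ ?_ fun u hu => ?_
    · rw [show Li * (L * A' i * Lᵀ) * Liᵀ = (Li * L) * A' i * (Lᵀ * Liᵀ) by
        simp only [Matrix.mul_assoc], hLiL, hT, Matrix.one_mul, Matrix.mul_one]
    · have := (hA' i).mul_mul_conjTranspose_same L
      rwa [conjTranspose_eq_transpose_of_trivial] at this
    · rw [← hc2]
      exact le_sq_of_sqrt_le (dotProduct_self_nonneg' _) (hLU u (Set.mem_union_left _ ⟨i, hu⟩))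
  · refine posSemidef_smul_one_sub hc2nn hT' (A' := B' j) ?_ ?_ fun v hv => ?_
    · rw [transpose_transpose, show Lᵀ * (Liᵀ * B' j * Li) * L = (Lᵀ * Liᵀ) * B' j * (Li * L) by
        simp only [Matrix.mul_assoc], hT, hLiL, Matrix.one_mul, Matrix.mul_one]
    · have := (hB' j).mul_mul_conjTranspose_same Liᵀ
      rwa [conjTranspose_eq_transpose_of_trivial, transpose_transpose] at this
    · rw [← hc2]
      exact le_sq_of_sqrt_le (dotProduct_self_nonneg' _) (hLV v (Set.mem_union_left _ ⟨j, hv⟩))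

end John

/-! ### GRT 2013 Example 2.3: `rank M = √rank M = 3` while `rank_psd M = 2` (appended) -/

section GrtEx23

/-- GRT's matrix `M = [[1,1,1],[1,0,1],[0,1,1]]`. [cite: GouveiaRobinsonThomas2013, Ex. 2.3 (p05)] -/
def grtEx23 : Matrix (Fin 3) (Fin 3) ℝ := !![1, 1, 1; 1, 0, 1; 0, 1, 1]

/-- The three printed row factors `[[½,−½],[−½,1]]`, `[[½,0],[0,0]]`, `[[0,0],[0,1]]`.
[cite: GouveiaRobinsonThomas2013, Ex. 2.3 (p05)] -/
def grtEx23Row : Fin 3 → Matrix (Fin 2) (Fin 2) ℝ :=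
  ![!![1/2, -1/2; -1/2, 1], !![1/2, 0; 0, 0], !![0, 0; 0, 1]]

/-- The three printed column factors `[[2,0],[0,0]]`, `[[0,0],[0,1]]`, `[[2,1],[1,1]]`.
[cite: GouveiaRobinsonThomas2013, Ex. 2.3 (p05)] -/
def grtEx23Col : Fin 3 → Matrix (Fin 2) (Fin 2) ℝ :=
  ![!![2, 0; 0, 0], !![0, 0; 0, 1], !![2, 1; 1, 1]]

/-- A symmetric `2 × 2` real matrix with nonnegative diagonal and determinant is psd. [folklore] -/
private theorem posSemidef_two {p q r : ℝ} (hp : 0 ≤ p) (hr : 0 ≤ r) (hq : q ^ 2 ≤ p * r) :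
    (!![p, q; q, r] : Matrix (Fin 2) (Fin 2) ℝ).PosSemidef := by
  refine PosSemidef.of_dotProduct_mulVec_nonneg ?_ fun x => ?_
  · rw [Matrix.IsHermitian, Matrix.conjTranspose_eq_transpose_of_trivial]
    exact Matrix.IsSymm.ext fun i j => by fin_cases i <;> fin_cases j <;> rfl
  · have h : star x ⬝ᵥ (!![p, q; q, r] *ᵥ x) = p * x 0 ^ 2 + 2 * q * x 0 * x 1 + r * x 1 ^ 2 := by
      simp [dotProduct, Matrix.mulVec, Fin.sum_univ_two]
      ring
    rw [h]
    -- `p (p x₀² + 2 q x₀ x₁ + r x₁²) = (p x₀ + q x₁)² + (p r − q²) x₁² ≥ 0`, and the case `p = 0`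
    rcases hp.eq_or_lt with hp0 | hp0
    · have hq0 : q = 0 := by nlinarith [sq_nonneg q]
      subst hp0; subst hq0
      nlinarith [sq_nonneg (x 1)]
    · have key : p * (p * x 0 ^ 2 + 2 * q * x 0 * x 1 + r * x 1 ^ 2) =
          (p * x 0 + q * x 1) ^ 2 + (p * r - q ^ 2) * x 1 ^ 2 := by ring
      have hnn : 0 ≤ p * (p * x 0 ^ 2 + 2 * q * x 0 * x 1 + r * x 1 ^ 2) := by
        rw [key]; nlinarith [sq_nonneg (p * x 0 + q * x 1), sq_nonneg (x 1)]
      exact nonneg_of_mul_nonneg_right hnn hp0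

/-- **GRT Example 2.3, the factorization** (p05): the six printed matrices are psd and give a
`S^2_+`-factorization of `M`; the first row factor and the third column factor are nonsingular
("both have rank two"). [cite: GouveiaRobinsonThomas2013, Ex. 2.3 (p05)] -/
theorem grtEx23_factorization :
    (∀ i, (grtEx23Row i).PosSemidef) ∧ (∀ j, (grtEx23Col j).PosSemidef) ∧
      (∀ i j, grtEx23 i j = (grtEx23Row i * grtEx23Col j).trace) ∧
      (grtEx23Row 0).det ≠ 0 ∧ (grtEx23Col 2).det ≠ 0 := by
  refine ⟨fun i => ?_, fun j => ?_, fun i j => ?_, ?_, ?_⟩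
  · fin_cases i
    · exact posSemidef_two (by norm_num) (by norm_num) (by norm_num)
    · exact posSemidef_two (by norm_num) le_rfl (by norm_num)
    · exact posSemidef_two le_rfl (by norm_num) (by norm_num)
  · fin_cases j
    · exact posSemidef_two (by norm_num) le_rfl (by norm_num)
    · exact posSemidef_two le_rfl (by norm_num) (by norm_num)
    · exact posSemidef_two (by norm_num) (by norm_num) (by norm_num)
  · fin_cases i <;> fin_cases j <;>
      norm_num [grtEx23, grtEx23Row, grtEx23Col, Matrix.trace, Matrix.mul_apply, Fin.sum_univ_two]
  · norm_num [grtEx23Row, Matrix.det_fin_two]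
  · simp [grtEx23Col, Matrix.det_fin_two]
    norm_num

/-- `det M = −1`, so `rank M = 3`. [cite: GouveiaRobinsonThomas2013, Ex. 2.3 (p05)] -/
theorem rank_grtEx23 : grtEx23.rank = 3 := by
  have hdet : grtEx23.det ≠ 0 := by
    rw [grtEx23, Matrix.det_fin_three]; simp
  simpa using Matrix.rank_of_isUnit _
    ((Matrix.isUnit_iff_isUnit_det _).mpr (isUnit_iff_ne_zero.mpr hdet))

/-- **Every Hadamard square root of `M` has rank `3`**: the sign pattern gives
`det √M = −ε₀₀ε₁₂ε₂₁ − ε₀₁ε₁₀ε₂₂ + ε₀₂ε₁₀ε₂₁`, a sum of three signs, which is odd, hence nonzero.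
[cite: GouveiaRobinsonThomas2013, Ex. 2.3 (p05)] -/
theorem rank_eq_three_of_sq_eq_grtEx23 (N : Matrix (Fin 3) (Fin 3) ℝ)
    (hN : ∀ i j, N i j ^ 2 = grtEx23 i j) : N.rank = 3 := by
  have h1 : ∀ i j, grtEx23 i j = 1 → N i j = 1 ∨ N i j = -1 := by
    intro i j hij
    have := hN i j
    rw [hij] at this
    have : (N i j - 1) * (N i j + 1) = 0 := by nlinarith
    rcases mul_eq_zero.mp this with h | h
    · exact Or.inl (by linarith)
    · exact Or.inr (by linarith)
  have h0 : ∀ i j, grtEx23 i j = 0 → N i j = 0 := by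
    intro i j hij
    have := hN i j
    rw [hij] at this
    exact pow_eq_zero_iff (n := 2) (by norm_num) |>.mp this
  have e11 : N 1 1 = 0 := h0 1 1 (by simp [grtEx23])
  have e20 : N 2 0 = 0 := h0 2 0 (by simp [grtEx23])
  -- the three sign products
  have sq1 : ∀ x : ℝ, x = 1 ∨ x = -1 → x ^ 2 = 1 := by
    rintro x (rfl | rfl) <;> norm_num
  have p1 : (N 0 0 * N 1 2 * N 2 1) ^ 2 = 1 := by
    rw [mul_pow, mul_pow, sq1 _ (h1 0 0 (by simp [grtEx23])), sq1 _ (h1 1 2 (by simp [grtEx23])),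
      sq1 _ (h1 2 1 (by simp [grtEx23]))]; norm_num
  have p2 : (N 0 1 * N 1 0 * N 2 2) ^ 2 = 1 := by
    rw [mul_pow, mul_pow, sq1 _ (h1 0 1 (by simp [grtEx23])), sq1 _ (h1 1 0 (by simp [grtEx23])),
      sq1 _ (h1 2 2 (by simp [grtEx23]))]; norm_num
  have p3 : (N 0 2 * N 1 0 * N 2 1) ^ 2 = 1 := by
    rw [mul_pow, mul_pow, sq1 _ (h1 0 2 (by simp [grtEx23])), sq1 _ (h1 1 0 (by simp [grtEx23])),
      sq1 _ (h1 2 1 (by simp [grtEx23]))]; norm_num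
  have hdet : N.det = -(N 0 0 * N 1 2 * N 2 1) - N 0 1 * N 1 0 * N 2 2 + N 0 2 * N 1 0 * N 2 1 := by
    rw [Matrix.det_fin_three, e11, e20]; ring
  have hsgn : ∀ x : ℝ, x ^ 2 = 1 → x = 1 ∨ x = -1 := by
    intro x hx
    have : (x - 1) * (x + 1) = 0 := by nlinarith
    rcases mul_eq_zero.mp this with h | h
    · exact Or.inl (by linarith)
    · exact Or.inr (by linarith)
  have hne : N.det ≠ 0 := by
    rw [hdet]
    rcases hsgn _ p1 with q1 | q1 <;> rcases hsgn _ p2 with q2 | q2 <;> rcases hsgn _ p3 with q3 | q3 <;>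
      rw [q1, q2, q3] <;> norm_num
  simpa using Matrix.rank_of_isUnit _
    ((Matrix.isUnit_iff_isUnit_det _).mpr (isUnit_iff_ne_zero.mpr hne))

/-- **GRT Example 2.3** (p05, verbatim): "For the matrix `M := [[1,1,1],[1,0,1],[0,1,1]]`,
`rank M = √rank M = 3` while `rank_psd M = 2`" (so the bound `rank_psd M ≤ √rank M` of
Proposition 2.2 = FGPRT Cor. 5.3 can be strict), and "we cannot find `S^k_+`-factorizations of `M`
with only rank one factors if `k < √rank M`" (Lemma 2.4 = FGPRT Prop. 6.2): no size-`2` psd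
factorization of `M` consists of rank-one factors. Typed with `√rank` as `HasHadamardSqrtOfRankLE`.
[cite: GouveiaRobinsonThomas2013, Ex. 2.3 and Lemma 2.4 (p05)] -/
theorem GouveiaRobinsonThomas2013_ex23 :
    grtEx23.rank = 3 ∧
    (HasHadamardSqrtOfRankLE grtEx23 3 ∧ ¬ HasHadamardSqrtOfRankLE grtEx23 2) ∧
    (HasPsdFactorization grtEx23 2 ∧ ¬ HasPsdFactorization grtEx23 1) ∧
    ¬ ∃ (A B : Fin 3 → Matrix (Fin 2) (Fin 2) ℝ),
      (∀ i, (A i).PosSemidef ∧ (A i).rank ≤ 1) ∧ (∀ j, (B j).PosSemidef ∧ (B j).rank ≤ 1) ∧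
      ∀ i j, grtEx23 i j = (A i * B j).trace := by
  obtain ⟨hA, hB, hM, -, -⟩ := grtEx23_factorization
  have hsqrt2 : ¬ HasHadamardSqrtOfRankLE grtEx23 2 := by
    rintro ⟨N, hN, hr⟩
    have := rank_eq_three_of_sq_eq_grtEx23 N hN
    omega
  refine ⟨rank_grtEx23, ⟨⟨grtEx23, fun i j => ?_, rank_grtEx23.le⟩, hsqrt2⟩,
    ⟨⟨grtEx23Row, grtEx23Col, hA, hB, hM⟩, fun h1 => ?_⟩, fun h => hsqrt2 ?_⟩
  · -- `M` is `0/1`, hence its own Hadamard square root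
    fin_cases i <;> fin_cases j <;> simp [grtEx23]
  · have := h1.rank_le_choose
    rw [rank_grtEx23] at this
    norm_num [Nat.choose] at this
  · exact FawziEtAl2015_prop62_holds (Fin 3) (Fin 3) grtEx23 2 h

end GrtEx23

end Literature.Combinatorics.Optimization
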